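import Mathlib.MeasureTheory.Integral.Lebesgue.Basic
import Literature.Geometry.Lorentzian.LateTimeOmegaLimitSet
import Literature.Geometry.Lorentzian.RecedingKerrInitialLayerNorm
import Literature.Geometry.Lorentzian.SelfSimilarUnstableMode
import HarnessLib

/-!
# Non-radiating Burnett limits on Kerr–Schild slabs (flux form, Lipschitz regularity)

Route-posited notion `NonRadiatingBurnettLimit` (route BurnettKineticRigidity of the final state
conjecture, crux OmegaLimitsNonRadiating = the LaSalle leg of late-time Burnett compactness). The
input is a reference background `B` (`ModelBackground`; intended: `Kerr.background M a` in ingoing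
Kerr–Schild coordinates), a slab `S_L = {τ₀ < t < τ₀ + L}` (`ModelBackground.timeSlabIoo`) and a
chart-level LIMIT PAIR `(g, μ)`: metric components `g : E4 → E4 →L[ℝ] E4 →L[ℝ] ℝ` (a late-time
Burnett ω-limit, `Spacetime.lateTimeBurnettDefectOmegaLimitSet`: locally Lipschitz, uniformly
non-degenerate — NOT a smooth spacetime) and its defect measure `μ` on the cosphere bundle
`E4 × S³` (`IsBurnettDefectDatum`), whose second fibre moments `T_{γδ} = ∫ ω_γ ω_δ dμ_x` are the
effective (massless Vlasov) stress-energy tensor (Huneau–Luk arXiv:1907.10743, Rem. 4.3). The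
conformal / Bondi / news vocabulary of the tree (`BondiNewsFlux.lean`, `TimelikeTubeEnergyFlux.lean`)
needs smooth manifolds and traces of `∂g` on surfaces, so it does not apply; everything here is a
first-order expression in `g` integrated over OPEN SHELLS of the slab (smeared cylinders), which is
meaningful for Lipschitz `g` (`∂g ∈ L^∞_loc`, Rademacher) and for measures `μ`.

## The definition

Let `S_{t,ρ} = {t = const, r = ρ}` be the coordinate spheres of `B` (`t = B.time`, `r = B.radius`).
At `x`, with `♯ = (g x)⁻¹` (`MetricCoord.sharpAt`), `dt = D(B.time)(x)`, `dr = D(B.radius)(x)`,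
`a = dt(♯dt)`, `b = dt(♯dr)`, `c = dr(♯dr)`, `D = b² − ac` (`> 0` iff the `g`-normal plane
`♯ span{dt, dr}` of `S_{t,ρ}` is timelike) and `s = √D`, the two future null normals of `S_{t,ρ}`
NORMALISED BY THE SLAB TIME, `dt(L) = dt(N) = 1`, are

  `L = ♯(((s − b)/(a s)) dt + s⁻¹ dr)` (outgoing, `dr(L) = (b − s)/a`),
  `N = ♯(((b + s)/(a s)) dt − s⁻¹ dr)` (ingoing, `dr(N) = (b + s)/a`), `g(L, N) = 2/a`

(`CoordSphere.outNull`, `CoordSphere.inNull`; Minkowski: `L = ∂_t + ∂_r`, `N = ∂_t − ∂_r`). For a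
null normal field `V` the null second fundamental form of the spheres is `χ_V = ½ (ℒ_V g)|_{TS}`
(Ashtekar–Krishnan 2004, §2.1.1: `σ_{ab} = ∇_{(a}ℓ_{b)} − ½ Θ q_{ab}`, "equivalent to `ℒ_ℓ q_{ab}`"),
with `ℒ_V g = MetricCoord.lieDerivAt g V` (partial derivatives of `g` and `V` only, no Christoffel
symbols), and its trace-free part `σ_V` (the SHEAR) has
`|σ_V|²_q = ¼ (|ℒ_V g|²_q − ½ (tr_q ℒ_V g)²)` (`CoordSphere.shearSq`), traces over `TS` being taken
with the projected inverse metric `q♯ = ♯ − (L ⊗ ev_N + N ⊗ ev_L)/g(L,N)` (`CoordSphere.surfSharp`).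
The **focusing (radiative) flux of `V` through the cylinders `C_s = S_L ∩ {r = s}`, smeared over
`ρ₁ < s < ρ₂`**, is the `ℝ≥0∞`-valued

  `𝔉_V(ρ₁, ρ₂) = ∫_{shell} √D |σ_V|²_q √|det g| dx + ∫_{shell × S³} √D ⟪ω, V_x⟫² dμ(x, ω)`

(`ModelBackground.focusingFlux`; `shell = S_L ∩ {ρ₁ < r < ρ₂}`, `ModelBackground.slabShell`): the
two Raychaudhuri source terms `σ_{ab}σ^{ab} + R_{ab}V^aV^b` of the congruence `V` (Hawking–Ellis
(4.35); with the Einstein–Vlasov equation of the limit, `∫ ψ Ric(V,V) dVol_g = ∫ ψ ⟪ω,V⟫² dμ`,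
Huneau–Luk arXiv:2403.03470, Thm. 1.5 (2)), integrated against `√D dVol_g = dt ∧ dr ∧ dA_q`
(`det g = −det q / D` in coordinates `(t, r, y^A)`), so that `𝔉_V(ρ₁, ρ₂) = ∫_{ρ₁}^{ρ₂} (∫_{C_s} (…) dA_q dt) ds`
is exactly the `s`-integral of the cylinder fluxes — non-degenerate even where `C_s` is null.

* OUTGOING radiation is measured by the INGOING normal: `outgoingFlux = 𝔉_N`. At null infinity
  `r χ̂_N → −2Ξ`, the news, and the Bondi mass loss is `∂_u M = (8π)⁻¹ ∮ |Ξ|²` plus the matter flux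
  `lim r² T(N, N)` (Christodoulou–Klainerman 1993, Ch. 17, (17.0.7), Conclusion 17.0.4; Bondi–van der
  Burg–Metzner 1962 / Sachs 1962, mass-loss formula): NO OUTGOING RADIATION through the far end of the
  slab is `𝔉_N(R, R + 1) → 0` as `R → ∞` — the Bondi limit is the defining clause, as requested.
* INGOING radiation (into the hole) is measured by the OUTGOING normal: `ingoingFlux = 𝔉_L`. On an
  event horizon generated by `ℓ` the area grows by `dθ/dv = … |σ|² + 4π T_{ab}ℓ^aℓ^b`
  (Hawking–Hartle 1972, (5), (12)–(14); the "Hawking-area form"), and a horizon is NON-EXPANDING —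
  in equilibrium, "no flux of matter or gravitational radiation across it" — iff
  `R_{ab}ℓ^aℓ^b + σ_{ab}σ^{ab} = 0` (Ashtekar–Krishnan 2004, §2.1.1, Def. 1 and the display after it).
  NO INGOING RADIATION through the inner end `r ↓ r_in` of the chart is the Cesàro form
  `(ρ − r_in)⁻¹ 𝔉_L(r_in, ρ) → 0` as `ρ ↓ r_in` (the average of the cylinder fluxes over
  `r_in < s < ρ`; for `Kerr.background M a`, `r_in = max r₊ 0`, the future event horizon `{r = r₊}`
  being the inner end of every Kerr–Schild slab).
* `ModelBackground.IsNonRadiatingLimit B r_in τ₀ L g μ` is the conjunction of these two clauses with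
  the ADAPTEDNESS of the slab to `g` (`ModelBackground.IsAdaptedSlab`: `a < 0` and `D > 0` on `S_L`,
  i.e. `dt` timelike and the coordinate spheres with timelike normal planes — automatic under the
  crux's uniform non-degeneracy T1, and excluding the junk regime in which all fluxes vanish);
  `Kerr.IsNonRadiatingLimit M a τ₀ L g μ` is the Kerr–Schild instance.

## Why this form (design choices)

* *Directional and sign-definite, not a net flux.* The net Killing-energy flux through `C_R` is
  `−T(∂_t, n) = ¼ (T(N,N) − T(L,L))` (Minkowski normalisation; in general up to shift terms that
  vanish where `g → η`) — outgoing minus ingoing. A net flux (Landau–Lifshitz `(−g) t^{0i} n_i`,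
  `LandauLifshitzPseudotensor.lean`, or Dafermos–Rodnianski's `J^T · n`) cancels for radiation
  crossing the ball (a plane-fronted null dust entering `C_R` on one side and leaving on the other has
  net flux `0` at every time), is indefinite (no lower semicontinuity under weak-* limits of `∂g`,
  which is how the crux intends to pass to ω-limits), and the tree's pseudotensor is second order in
  `g`. The two one-signed halves `T(N,N) + |σ_N|²` (far end) and `T(L,L) + |σ_L|²` (inner end) are
  first order, convex in `∂g` for frozen `N`, and are what the Bondi and Hawking–Hartle formulas
  integrate.
* *Normalisation by `dt`, not by `∂_t`.* `∂_{t*}` is spacelike in the Kerr ergoregion, so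
  `g(V, ∂_{t*}) = −1` degenerates; `dt*(V) = 1` does not (the slices are spacelike, `a = g^{00} < 0`
  is the crux's uniform non-degeneracy hypothesis T1). Rescaling `V ↦ λV` rescales `𝔉_V` by `λ²`.
* *Weights.* `√D dVol_g` makes `𝔉` the honest `dr`-integral of cylinder integrals w.r.t. `dA_q dt`;
  any weight bounded above and below would give an equivalent far-end condition, but `D → 0` where the
  cylinders become null (a horizon), so the weight matters at the inner end.
* *`ℝ≥0∞`-valued lower integrals* (`∫⁻ … ENNReal.ofReal`): no integrability junk — a non-integrable
  flux is `∞` and then the limit conditions fail, instead of holding vacuously.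
* *Junk values.* `a = 0` or `D ≤ 0` (the sphere `S_{t,ρ}` not spacelike for `g`, or `g x` degenerate)
  give junk `L`, `N` through division by zero / `Real.sqrt`; `|σ_V|²_q` is clipped at `0` by
  `ENNReal.ofReal`. The field `isAdaptedSlab` (`a < 0`, `D > 0` on `S_L`) rules this regime out, so
  the condition cannot hold vacuously (e.g. for Riemannian or zero components).
* *Generality.* Stated for any `ModelBackground` (only `domain`, `time`, `radius` are used) with the
  inner radius `r_in` explicit; `E4` throughout (the constant `½ = 1/dim S` is that of `2`-spheres in
  `4` dimensions).

## API proved here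

`mem_slabShell`, `slabShell_subset_image_timeSlabIoo`, `slabShell_mono`; the algebra of the null
normals under `(g x).IsInvertible`, symmetry, `a ≠ 0`, `0 < D`: `fderiv_time_outNull/inNull = 1`,
`apply_outNull_outNull = 0`, `apply_inNull_inNull = 0`, `apply_outNull_inNull = 2/a`,
`fderiv_radius_outNull/inNull`, orthogonality to `TS = ker dt ∩ ker dr`, `L + N = (2/a) ♯dt`, and the
projector identities `q♯ dt = q♯ dr = 0`, `g(q♯ α, L) = g(q♯ α, N) = 0` (`surfSharp_fderiv_time/radius`,
`apply_surfSharp_outNull/inNull`); `focusingFlux_mono`,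
`focusingFlux_zero_measure` (for `μ = 0` only the shear term remains); `IsNonRadiatingLimit.anti`
(sub-slabs inherit the property), `IsNonRadiatingLimit.mono_length`; TRANSLATION COVARIANCE
(requirement (iii) of the request, the residual time-translation gauge of late-time limits): the null
normals, `q♯`, the shear density and the fluxes of the translated pair `(g(· + T∂₀), μ(· + T∂₀))` on
`S_L(τ₀)` are those of `(g, μ)` on `S_L(τ₀ + T)` for a stationary background
(`CoordSphere.outNull_comp_add`, `….shearSq_comp_add`, `ModelBackground.focusingFlux_timeShift`,
`….isNonRadiatingLimit_timeShift_iff`); the Kerr unfolding lemmas; and the FLAT CASE: for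
constant components `η` on `Kerr.background 0 0` (`t = x⁰`, `r = |x̲|`), `♯dx⁰ = −∂₀`,
`♯d|x̲| = r̂`, `a = −1`, `b = 0`, `c = 1`, `D = 1`, `L = ∂₀ + r̂`, `N = ∂₀ − r̂` off the time axis
(`CoordSphere.outNull_flat`, `CoordSphere.inNull_flat` — they are `Minkowski.outgoingNull`,
`Minkowski.ingoingNull` of the tree), certifying the orientation and lapse normalisation of the null
pair; `D r̂ = |x̲|⁻¹ Π` (`CoordSphere.hasFDerivAt_radialUnit`), `ℒ_N η = −(2/|x̲|) η(Π ·, ·)`,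
`tr Π = 2`, `q♯ ∘ η(Π ·, ·) = Π`, whence both flat shears vanish (`CoordSphere.shearSq_inNull_flat`,
`….shearSq_outNull_flat`) and **MINKOWSKI SPACE IS A NON-RADIATING LIMIT PAIR**,
`Kerr.isNonRadiatingLimit_minkowski : Kerr.IsNonRadiatingLimit 0 0 τ₀ L (fun _ ↦ η) 0` — the
requested sanity statement "`(g_{M,a}, 0)` is non-radiating" in the case `M = a = 0`.

## Deliberately NOT here (sanity statements requested by the route, not proved in this file)

* `(g_{M,a}, 0)` in Kerr–Schild coordinates is non-radiating for `(M, a) ≠ (0, 0)`: for `a ≠ 0` the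
  coordinate spheres `S_{t*,r}` are not adapted to the principal null directions, so `σ_N` need not
  vanish at finite `r` (only its far-shell integrals tend to `0`) and `σ_L → 0` only as `r → r₊`
  (Killing horizon); for `a = 0 < M` both shears vanish identically (round spheres, radial null
  normals) by the same computation as the flat case with `η` replaced by `η + (2M/r) ℓ ⊗ ℓ` — a
  separate proof file.
  Likewise static Einstein–massless-Vlasov shells (Andréasson 2021; `StaticMasslessVlasovShell.lean`)
  supported in `{r ≤ R₀}`: `𝔉_N(R, R+1)` has no kinetic part for `R > R₀`.
* NOT non-radiating (informal): an outgoing null dust `μ = ρ(x) δ_{L♭/|L♭|}` on the far shells has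
  `⟪ω, N⟫² = g(L,N)²/|L♭|² > 0`, so `𝔉_N(R, R+1) ≥ c · μ(shell × S³)` does not tend to `0`; a
  plane-fronted null dust crossing the slab (Touati-type limits) has `⟪ω, N_x⟫ ≠ 0` except on the
  single ray where it is exactly radially ingoing.
* BMS supertranslations (expected to change `𝔉_N(R, R+1)` by `o(1)` as `R → ∞`), the identification
  of `lim_R 𝔉_N` with the news flux of a development, lower semicontinuity of `𝔉` under
  `BurnettConverges` with defect measures — theorems for the route, not definitions.

## References

* A. Ashtekar, B. Krishnan, *Isolated and dynamical horizons and their applications*, Living Rev.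
  Relativ. 7 (2004) 10, §2.1.1 (Def. 1, `R_{ab}ℓ^aℓ^b + σ_{ab}σ^{ab} = 0`), §3.3 (energy flux).
* S. W. Hawking, J. B. Hartle, *Energy and angular momentum flow into a black hole*, CMP 27 (1972)
  283–290, (5), (12)–(14).
* D. Christodoulou, S. Klainerman, *The global nonlinear stability of the Minkowski space*, 1993,
  Ch. 17, (17.0.7), Conclusions 17.0.3–17.0.4; H. Bondi, M. van der Burg, A. Metzner, Proc. Roy. Soc.
  A 269 (1962); R. Sachs, Proc. Roy. Soc. A 270 (1962) (mass loss).
* C. Huneau, J. Luk, arXiv:1907.10743, Rem. 4.3 (effective stress tensor of `μ`); arXiv:2403.03470,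
  Thm. 1.5 (2) (`Ric = T[μ]` for Burnett limits).
* S. W. Hawking, G. F. R. Ellis, 1973, §4.2, (4.35) (Raychaudhuri for null congruences).
* M. Dafermos, I. Rodnianski, arXiv:0811.0354, §5.1 and App. D (Kerr–Schild slabs, energy currents);
  arXiv:0910.4957, §3 (the flat null frame `L = ∂_t + ∂_r`, `L̲ = ∂_t − ∂_r`).
* M. Visser, arXiv:0706.0622, (35) (the Kerr–Schild radius).
-/

noncomputable section

-- nested operator spaces `E4 →L[ℝ] E4 →L[ℝ] E4 →L[ℝ] ℝ` (derivatives of the components), as in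
-- `CoordCurvature.lean`
set_option maxSynthPendingDepth 3

open Set Filter
open _root_.MeasureTheory _root_.Topology
open scoped ENNReal Topology RealInnerProductSpace

namespace Literature.Geometry.Lorentzian

/-! ### Null normals of the coordinate spheres and their shears -/

namespace CoordSphere

variable (t r : E4 → ℝ) (g : E4 → E4 →L[ℝ] E4 →L[ℝ] ℝ)

/-- `a = g⁻¹(dt, dt) = dt(♯dt)`, the `tt`-component of the inverse metric on the conormal plane
`span{dt, dr}` of the coordinate spheres (`g^{00}` for `t = x⁰`; negative iff `dt` is timelike).
[folklore] -/
def invTT (x : E4) : ℝ :=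
  fderiv ℝ t x (MetricCoord.sharpAt g x (fderiv ℝ t x))

/-- `b = g⁻¹(dt, dr) = dt(♯dr)`. [folklore] -/
def invTR (x : E4) : ℝ :=
  fderiv ℝ t x (MetricCoord.sharpAt g x (fderiv ℝ r x))

/-- `c = g⁻¹(dr, dr) = dr(♯dr)` (positive iff the cylinders `{r = const}` are timelike at `x`).
[folklore] -/
def invRR (x : E4) : ℝ :=
  fderiv ℝ r x (MetricCoord.sharpAt g x (fderiv ℝ r x))

/-- The discriminant `D = b² − ac = −det (g⁻¹|_{span{dt,dr}})`: positive iff the `g`-normal plane of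
the coordinate sphere through `x` is timelike (iff the sphere is spacelike, for Lorentzian `g`); in
adapted coordinates `det g = −det q / D`. [folklore] -/
def discr (x : E4) : ℝ :=
  invTR t r g x ^ 2 - invTT t g x * invRR r g x

/-- The conormal `θ_L = ((s − b)/(a s)) dt + s⁻¹ dr`, `s = √D`, whose `♯` is the outgoing null normal.
[folklore] -/
def outConormal (x : E4) : E4 →L[ℝ] ℝ :=
  ((Real.sqrt (discr t r g x) - invTR t r g x) / (invTT t g x * Real.sqrt (discr t r g x))) •
      fderiv ℝ t x +
    (Real.sqrt (discr t r g x))⁻¹ • fderiv ℝ r x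

/-- The conormal `θ_N = ((b + s)/(a s)) dt − s⁻¹ dr`, `s = √D`, whose `♯` is the ingoing null normal.
[folklore] -/
def inConormal (x : E4) : E4 →L[ℝ] ℝ :=
  ((invTR t r g x + Real.sqrt (discr t r g x)) / (invTT t g x * Real.sqrt (discr t r g x))) •
      fderiv ℝ t x +
    (-(Real.sqrt (discr t r g x))⁻¹) • fderiv ℝ r x

/-- The **outgoing future null normal `L`** of the coordinate sphere `{t = t(x), r = r(x)}` at `x`
with respect to the components `g`, normalised by `dt(L) = 1`: `L = ♯θ_L` (so `g(L, L) = 0`,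
`dr(L) = (b − s)/a`, which is `≥ dr(N)` for `a < 0`; `L ⊥ ker dt ∩ ker dr`; Minkowski: `∂_t + ∂_r`).
The generator `ℓ` of Ashtekar–Krishnan 2004, §2.1.1 / the `e₄ = T + n̂` of Christodoulou–Klainerman
1993, Ch. 17 (`n̂` the outward unit normal), in the lapse normalisation of the slab time. Junk where
`a = 0` or `D ≤ 0`. [cite: AshtekarKrishnan2004, §2.1.1] -/
def outNull (x : E4) : E4 :=
  MetricCoord.sharpAt g x (outConormal t r g x)

/-- The **ingoing future null normal `N`** of the coordinate sphere through `x`, `dt(N) = 1`: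
`N = ♯θ_N` (`g(N, N) = 0`, `dr(N) = (b + s)/a`, `g(L, N) = 2/a`; Minkowski: `∂_t − ∂_r`), the
`e₃ = T − n̂` of Christodoulou–Klainerman 1993, Ch. 17 (`n̂` the outward unit normal) whose trace-free
null second fundamental form `χ̲̂` carries the news (`r χ̲̂ → −2Ξ`, Conclusion 17.0.3).
[cite: ChristodoulouKlainerman1993, Ch. 17, Conclusion 17.0.3] -/
def inNull (x : E4) : E4 :=
  MetricCoord.sharpAt g x (inConormal t r g x)

/-- The **projected inverse metric** `q♯ : E4* → E4` of the coordinate sphere through `x`: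
`q♯ α = ♯α − (α(N) L + α(L) N)/g(L, N)`, i.e. `q^{μν} = g^{μν} − (L^μN^ν + N^μL^ν)/g(L,N)`. It kills
the conormals `dt, dr`, takes values in `TS = ker dt ∩ ker dr = {L, N}^⊥` and inverts the induced
metric `q = g|_{TS}` there (Ashtekar–Krishnan 2004, §2.1.1, the "inverse" `q^{ab}` of the degenerate
`q_{ab}`; Gourgoulhon–Jaramillo 2006, the projector onto the screen space). [cite: AshtekarKrishnan2004, §2.1.1] -/
def surfSharp (x : E4) : (E4 →L[ℝ] ℝ) →L[ℝ] E4 :=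
  MetricCoord.sharpAt g x -
    (g x (outNull t r g x) (inNull t r g x))⁻¹ •
      ((ContinuousLinearMap.apply ℝ ℝ (inNull t r g x)).smulRight (outNull t r g x) +
        (ContinuousLinearMap.apply ℝ ℝ (outNull t r g x)).smulRight (inNull t r g x))

/-- The **`q`-trace** `tr_q β = q^{μν} β_{μν} = tr (q♯ ∘ β)` of a bilinear form over the tangent
plane of the coordinate sphere (only `β|_{TS}` enters). [cite: AshtekarKrishnan2004, §2.1.1] -/
def surfTrace (x : E4) (β : E4 →L[ℝ] E4 →L[ℝ] ℝ) : ℝ :=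
  LinearMap.trace ℝ E4 (((surfSharp t r g x).comp β : E4 →L[ℝ] E4) : E4 →ₗ[ℝ] E4)

/-- The **`q`-square norm** `|β|²_q = q^{μα} q^{νβ} β_{μν} β_{βα} = tr ((q♯∘β) ∘ (q♯∘βᵗ))` of a
bilinear form over the tangent plane of the coordinate sphere (cf. `MetricCoord.normSqAt`).
[cite: AshtekarKrishnan2004, §2.1.1] -/
def surfNormSq (x : E4) (β : E4 →L[ℝ] E4 →L[ℝ] ℝ) : ℝ :=
  LinearMap.trace ℝ E4
    ((((surfSharp t r g x).comp β).comp ((surfSharp t r g x).comp β.flip) : E4 →L[ℝ] E4) :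
      E4 →ₗ[ℝ] E4)

/-- The **squared shear** `|σ_V|²_q = σ_{ab}σ^{ab}` at `x` of a (null normal) vector field `V` of the
coordinate spheres: `σ_V` is the `q`-trace-free part of the null second fundamental form
`χ_V = ½ (ℒ_V g)|_{TS}` (Ashtekar–Krishnan 2004, §2.1.1: `σ_{ab} = ∇_{(a}ℓ_{b)} − ½ Θ_{(ℓ)} q_{ab}`,
pulled back, "equivalent to `ℒ_ℓ q_{ab}`"), so in dimension `2`
`|σ_V|²_q = ¼ (|ℒ_V g|²_q − ½ (tr_q ℒ_V g)²)`, with `ℒ_V g = MetricCoord.lieDerivAt g V x` (first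
derivatives of `g` and of `V` only). The chart-level counterpart of `LorentzianMetric.nullShearNormSq`.
May be negative only for junk (non-Riemannian) `q`. [cite: AshtekarKrishnan2004, §2.1.1] -/
def shearSq (V : E4 → E4) (x : E4) : ℝ :=
  4⁻¹ * (surfNormSq t r g x (MetricCoord.lieDerivAt g V x) -
    2⁻¹ * surfTrace t r g x (MetricCoord.lieDerivAt g V x) ^ 2)

/-! #### Algebra of the null normals -/

section Algebra

variable {t r g} {x : E4}

/-- `dt(♯(p dt + q dr)) = p a + q b`. [folklore] -/
theorem fderiv_time_sharpAt (p q : ℝ) :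
    fderiv ℝ t x (MetricCoord.sharpAt g x (p • fderiv ℝ t x + q • fderiv ℝ r x)) =
      p * invTT t g x + q * invTR t r g x := by
  simp only [map_add, map_smul, smul_eq_mul, invTT, invTR]

/-- For symmetric invertible `g x` the pairing `α(♯β)` is symmetric: `α(♯β) = β(♯α)`
(`g^{μν} = g^{νμ}`). [folklore] -/
theorem apply_sharpAt_comm (hx : (g x).IsInvertible) (hs : ∀ v w : E4, g x v w = g x w v)
    (α β : E4 →L[ℝ] ℝ) :
    α (MetricCoord.sharpAt g x β) = β (MetricCoord.sharpAt g x α) := by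
  rw [← MetricCoord.apply_sharpAt_apply hx α, hs, MetricCoord.apply_sharpAt_apply hx]

/-- `dr(♯(p dt + q dr)) = p b + q c` (symmetric invertible `g x`). [folklore] -/
theorem fderiv_radius_sharpAt (hx : (g x).IsInvertible) (hs : ∀ v w : E4, g x v w = g x w v)
    (p q : ℝ) :
    fderiv ℝ r x (MetricCoord.sharpAt g x (p • fderiv ℝ t x + q • fderiv ℝ r x)) =
      p * invTR t r g x + q * invRR r g x := by
  simp only [map_add, map_smul, smul_eq_mul, invTR, invRR, apply_sharpAt_comm hx hs (fderiv ℝ r x)]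

/-- `g(♯(p dt + q dr), ♯(p' dt + q' dr)) = p (p' a + q' b) + q (p' b + q' c)`. [folklore] -/
theorem apply_sharpAt_sharpAt (hx : (g x).IsInvertible) (hs : ∀ v w : E4, g x v w = g x w v)
    (p q p' q' : ℝ) :
    g x (MetricCoord.sharpAt g x (p • fderiv ℝ t x + q • fderiv ℝ r x))
        (MetricCoord.sharpAt g x (p' • fderiv ℝ t x + q' • fderiv ℝ r x)) =
      p * (p' * invTT t g x + q' * invTR t r g x) + q * (p' * invTR t r g x + q' * invRR r g x) := by
  rw [MetricCoord.apply_sharpAt_apply hx, _root_.add_apply, _root_.smul_apply, _root_.smul_apply,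
    fderiv_time_sharpAt, fderiv_radius_sharpAt hx hs, smul_eq_mul, smul_eq_mul]

/-- `L` is orthogonal-dual to its conormal: `g(L, w) = θ_L(w)`. [folklore] -/
theorem apply_outNull (hx : (g x).IsInvertible) (w : E4) :
    g x (outNull t r g x) w = outConormal t r g x w :=
  MetricCoord.apply_sharpAt_apply hx _ w

/-- `N` is orthogonal-dual to its conormal: `g(N, w) = θ_N(w)`. [folklore] -/
theorem apply_inNull (hx : (g x).IsInvertible) (w : E4) :
    g x (inNull t r g x) w = inConormal t r g x w :=
  MetricCoord.apply_sharpAt_apply hx _ w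

/-- **`L` is normal to the coordinate sphere**: `g(L, w) = 0` for `w ∈ TS = ker dt ∩ ker dr`.
[cite: AshtekarKrishnan2004, §2.1.1] -/
theorem apply_outNull_of_mem_ker (hx : (g x).IsInvertible) {w : E4} (ht : fderiv ℝ t x w = 0)
    (hr : fderiv ℝ r x w = 0) : g x (outNull t r g x) w = 0 := by
  simp [apply_outNull hx, outConormal, ht, hr]

/-- **`N` is normal to the coordinate sphere**: `g(N, w) = 0` for `w ∈ TS = ker dt ∩ ker dr`.
[cite: AshtekarKrishnan2004, §2.1.1] -/
theorem apply_inNull_of_mem_ker (hx : (g x).IsInvertible) {w : E4} (ht : fderiv ℝ t x w = 0)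
    (hr : fderiv ℝ r x w = 0) : g x (inNull t r g x) w = 0 := by
  simp [apply_inNull hx, inConormal, ht, hr]

/-- **Lapse normalisation of `L`**: `dt(L) = 1` (whenever `a ≠ 0` and `D > 0`). [folklore] -/
theorem fderiv_time_outNull (ha : invTT t g x ≠ 0) (hD : 0 < discr t r g x) :
    fderiv ℝ t x (outNull t r g x) = 1 := by
  have hs : Real.sqrt (discr t r g x) ≠ 0 := (Real.sqrt_pos.2 hD).ne'
  rw [outNull, outConormal, fderiv_time_sharpAt]
  field_simp
  ring

/-- **Lapse normalisation of `N`**: `dt(N) = 1` (whenever `a ≠ 0` and `D > 0`). [folklore] -/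
theorem fderiv_time_inNull (ha : invTT t g x ≠ 0) (hD : 0 < discr t r g x) :
    fderiv ℝ t x (inNull t r g x) = 1 := by
  have hs : Real.sqrt (discr t r g x) ≠ 0 := (Real.sqrt_pos.2 hD).ne'
  rw [inNull, inConormal, fderiv_time_sharpAt]
  field_simp
  ring

/-- `dr(L) = (b − s)/a`. [folklore] -/
theorem fderiv_radius_outNull (hx : (g x).IsInvertible) (hs : ∀ v w : E4, g x v w = g x w v)
    (ha : invTT t g x ≠ 0) (hD : 0 < discr t r g x) :
    fderiv ℝ r x (outNull t r g x) =
      (invTR t r g x - Real.sqrt (discr t r g x)) / invTT t g x := by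
  have hs0 : Real.sqrt (discr t r g x) ≠ 0 := (Real.sqrt_pos.2 hD).ne'
  have hsq : Real.sqrt (discr t r g x) ^ 2 = invTR t r g x ^ 2 - invTT t g x * invRR r g x :=
    Real.sq_sqrt hD.le
  rw [outNull, outConormal, fderiv_radius_sharpAt hx hs]
  field_simp
  linear_combination hsq

/-- `dr(N) = (b + s)/a`. [folklore] -/
theorem fderiv_radius_inNull (hx : (g x).IsInvertible) (hs : ∀ v w : E4, g x v w = g x w v)
    (ha : invTT t g x ≠ 0) (hD : 0 < discr t r g x) :
    fderiv ℝ r x (inNull t r g x) =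
      (invTR t r g x + Real.sqrt (discr t r g x)) / invTT t g x := by
  have hs0 : Real.sqrt (discr t r g x) ≠ 0 := (Real.sqrt_pos.2 hD).ne'
  have hsq : Real.sqrt (discr t r g x) ^ 2 = invTR t r g x ^ 2 - invTT t g x * invRR r g x :=
    Real.sq_sqrt hD.le
  rw [inNull, inConormal, fderiv_radius_sharpAt hx hs]
  field_simp
  linear_combination -hsq

/-- **`L` is null**: `g(L, L) = 0` — the root `α₊` of `a α² + 2 b α + c = 0`. [cite: AshtekarKrishnan2004, §2.1.1] -/
theorem apply_outNull_outNull (hx : (g x).IsInvertible) (hs : ∀ v w : E4, g x v w = g x w v)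
    (ha : invTT t g x ≠ 0) (hD : 0 < discr t r g x) :
    g x (outNull t r g x) (outNull t r g x) = 0 := by
  have hs0 : Real.sqrt (discr t r g x) ≠ 0 := (Real.sqrt_pos.2 hD).ne'
  have hsq : Real.sqrt (discr t r g x) ^ 2 = invTR t r g x ^ 2 - invTT t g x * invRR r g x :=
    Real.sq_sqrt hD.le
  rw [outNull, outConormal, apply_sharpAt_sharpAt hx hs]
  field_simp
  linear_combination hsq

/-- **`N` is null**: `g(N, N) = 0` — the root `α₋` of `a α² + 2 b α + c = 0`. [cite: AshtekarKrishnan2004, §2.1.1] -/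
theorem apply_inNull_inNull (hx : (g x).IsInvertible) (hs : ∀ v w : E4, g x v w = g x w v)
    (ha : invTT t g x ≠ 0) (hD : 0 < discr t r g x) :
    g x (inNull t r g x) (inNull t r g x) = 0 := by
  have hs0 : Real.sqrt (discr t r g x) ≠ 0 := (Real.sqrt_pos.2 hD).ne'
  have hsq : Real.sqrt (discr t r g x) ^ 2 = invTR t r g x ^ 2 - invTT t g x * invRR r g x :=
    Real.sq_sqrt hD.le
  rw [inNull, inConormal, apply_sharpAt_sharpAt hx hs]
  field_simp
  linear_combination hsq

/-- **The null pair normalisation**: `g(L, N) = 2/a` (`= −2` for Minkowski components, the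
normalisation `g(e₃, e₄) = −2` of Christodoulou–Klainerman). [cite: ChristodoulouKlainerman1993, Ch. 17] -/
theorem apply_outNull_inNull (hx : (g x).IsInvertible) (hs : ∀ v w : E4, g x v w = g x w v)
    (ha : invTT t g x ≠ 0) (hD : 0 < discr t r g x) :
    g x (outNull t r g x) (inNull t r g x) = 2 / invTT t g x := by
  have hs0 : Real.sqrt (discr t r g x) ≠ 0 := (Real.sqrt_pos.2 hD).ne'
  have hsq : Real.sqrt (discr t r g x) ^ 2 = invTR t r g x ^ 2 - invTT t g x * invRR r g x :=
    Real.sq_sqrt hD.le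
  rw [outNull, outConormal, inNull, inConormal, apply_sharpAt_sharpAt hx hs]
  field_simp
  linear_combination -hsq

/-! #### The projected inverse metric kills the conormals and maps into the tangent plane -/

/-- Unfolding lemma: `q♯ α = ♯α − g(L,N)⁻¹ (α(N) L + α(L) N)`. [folklore] -/
theorem surfSharp_apply (α : E4 →L[ℝ] ℝ) :
    surfSharp t r g x α = MetricCoord.sharpAt g x α -
      (g x (outNull t r g x) (inNull t r g x))⁻¹ •
        (α (inNull t r g x) • outNull t r g x + α (outNull t r g x) • inNull t r g x) :=
  rfl

/-- `θ_L + θ_N = (2/a) dt`. [folklore] -/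
theorem outConormal_add_inConormal (ha : invTT t g x ≠ 0) (hD : 0 < discr t r g x) :
    outConormal t r g x + inConormal t r g x = (2 / invTT t g x) • fderiv ℝ t x := by
  have hs0 : Real.sqrt (discr t r g x) ≠ 0 := (Real.sqrt_pos.2 hD).ne'
  ext w
  simp only [outConormal, inConormal, _root_.add_apply, _root_.smul_apply, smul_eq_mul]
  field_simp
  ring

/-- `(b + s) θ_L + (b − s) θ_N = 2 dr`. [folklore] -/
theorem smul_outConormal_add_smul_inConormal (ha : invTT t g x ≠ 0) (hD : 0 < discr t r g x) :
    (invTR t r g x + Real.sqrt (discr t r g x)) • outConormal t r g x +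
        (invTR t r g x - Real.sqrt (discr t r g x)) • inConormal t r g x =
      (2 : ℝ) • fderiv ℝ r x := by
  have hs0 : Real.sqrt (discr t r g x) ≠ 0 := (Real.sqrt_pos.2 hD).ne'
  ext w
  simp only [outConormal, inConormal, _root_.add_apply, _root_.smul_apply, smul_eq_mul]
  field_simp
  ring

/-- `L + N = (2/a) ♯dt`: the lapse-normalised null pair spans the normal plane symmetrically about
`♯dt`. [folklore] -/
theorem outNull_add_inNull (ha : invTT t g x ≠ 0) (hD : 0 < discr t r g x) :
    outNull t r g x + inNull t r g x =
      (2 / invTT t g x) • MetricCoord.sharpAt g x (fderiv ℝ t x) := by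
  rw [outNull, inNull, ← map_add, outConormal_add_inConormal ha hD, map_smul]

/-- `(b + s) L + (b − s) N = 2 ♯dr`. [folklore] -/
theorem smul_outNull_add_smul_inNull (ha : invTT t g x ≠ 0) (hD : 0 < discr t r g x) :
    (invTR t r g x + Real.sqrt (discr t r g x)) • outNull t r g x +
        (invTR t r g x - Real.sqrt (discr t r g x)) • inNull t r g x =
      (2 : ℝ) • MetricCoord.sharpAt g x (fderiv ℝ r x) := by
  rw [outNull, inNull, ← map_smul, ← map_smul, ← map_add, smul_outConormal_add_smul_inConormal ha hD,
    map_smul]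

/-- **`q♯` kills `dt`**: `q♯(dt) = 0` (the conormals of the sphere are annihilated).
[cite: AshtekarKrishnan2004, §2.1.1] -/
theorem surfSharp_fderiv_time (hx : (g x).IsInvertible) (hs : ∀ v w : E4, g x v w = g x w v)
    (ha : invTT t g x ≠ 0) (hD : 0 < discr t r g x) :
    surfSharp t r g x (fderiv ℝ t x) = 0 := by
  have h2a : 2 / invTT t g x ≠ 0 := div_ne_zero two_ne_zero ha
  rw [surfSharp_apply, fderiv_time_outNull ha hD, fderiv_time_inNull ha hD, one_smul, one_smul,
    outNull_add_inNull ha hD, apply_outNull_inNull hx hs ha hD, smul_smul, inv_mul_cancel₀ h2a,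
    one_smul, sub_self]

/-- **`q♯` kills `dr`**: `q♯(dr) = 0`. [cite: AshtekarKrishnan2004, §2.1.1] -/
theorem surfSharp_fderiv_radius (hx : (g x).IsInvertible) (hs : ∀ v w : E4, g x v w = g x w v)
    (ha : invTT t g x ≠ 0) (hD : 0 < discr t r g x) :
    surfSharp t r g x (fderiv ℝ r x) = 0 := by
  have h := smul_outNull_add_smul_inNull (t := t) (r := r) (g := g) (x := x) ha hD
  rw [surfSharp_apply, fderiv_radius_outNull hx hs ha hD, fderiv_radius_inNull hx hs ha hD,
    apply_outNull_inNull hx hs ha hD, div_eq_mul_inv (invTR t r g x + _),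
    div_eq_mul_inv (invTR t r g x - _), mul_comm _ (invTT t g x)⁻¹, mul_comm _ (invTT t g x)⁻¹,
    mul_smul, mul_smul, ← smul_add, h, smul_smul, smul_smul, sub_eq_zero]
  rw [show (2 / invTT t g x)⁻¹ * (invTT t g x)⁻¹ * 2 = 1 by field_simp, one_smul]

/-- **`q♯` maps into the tangent plane, I**: `g(q♯ α, L) = 0` for every covector `α`.
[cite: AshtekarKrishnan2004, §2.1.1] -/
theorem apply_surfSharp_outNull (hx : (g x).IsInvertible) (hs : ∀ v w : E4, g x v w = g x w v)
    (ha : invTT t g x ≠ 0) (hD : 0 < discr t r g x) (α : E4 →L[ℝ] ℝ) :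
    g x (surfSharp t r g x α) (outNull t r g x) = 0 := by
  have hLN : g x (outNull t r g x) (inNull t r g x) ≠ 0 := by
    rw [apply_outNull_inNull hx hs ha hD]
    exact div_ne_zero two_ne_zero ha
  rw [surfSharp_apply, map_sub, map_smul, map_add, map_smul, map_smul, _root_.sub_apply,
    _root_.smul_apply, _root_.add_apply, _root_.smul_apply, _root_.smul_apply,
    MetricCoord.apply_sharpAt_apply hx, apply_outNull_outNull hx hs ha hD,
    hs (inNull t r g x) (outNull t r g x), smul_eq_mul, smul_eq_mul, smul_eq_mul, mul_zero, zero_add,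
    ← mul_assoc, mul_comm _ (α (outNull t r g x)), mul_assoc, inv_mul_cancel₀ hLN, mul_one, sub_self]

/-- **`q♯` maps into the tangent plane, II**: `g(q♯ α, N) = 0` for every covector `α`; with I,
`q♯ α ∈ {L, N}^⊥ = TS`. [cite: AshtekarKrishnan2004, §2.1.1] -/
theorem apply_surfSharp_inNull (hx : (g x).IsInvertible) (hs : ∀ v w : E4, g x v w = g x w v)
    (ha : invTT t g x ≠ 0) (hD : 0 < discr t r g x) (α : E4 →L[ℝ] ℝ) :
    g x (surfSharp t r g x α) (inNull t r g x) = 0 := by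
  have hLN : g x (outNull t r g x) (inNull t r g x) ≠ 0 := by
    rw [apply_outNull_inNull hx hs ha hD]
    exact div_ne_zero two_ne_zero ha
  rw [surfSharp_apply, map_sub, map_smul, map_add, map_smul, map_smul, _root_.sub_apply,
    _root_.smul_apply, _root_.add_apply, _root_.smul_apply, _root_.smul_apply,
    MetricCoord.apply_sharpAt_apply hx, apply_inNull_inNull hx hs ha hD, smul_eq_mul, smul_eq_mul,
    smul_eq_mul, mul_zero, add_zero, ← mul_assoc, mul_comm _ (α (inNull t r g x)), mul_assoc,
    inv_mul_cancel₀ hLN, mul_one, sub_self]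

end Algebra

/-! #### Translation covariance

If the differentials of `t` and `r` are invariant under the translation `x ↦ x + e` (e.g. the
`t*`-translations `e = T ∂₀` of a stationary background, `ModelBackground.IsStationary`), then every
object above built from the translated components `g(· + e)` at `x` is the object built from `g` at
`x + e`. -/

section Comp

variable {t r} {e : E4} (he : ∀ x : E4, fderiv ℝ t (x + e) = fderiv ℝ t x)
  (hr : ∀ x : E4, fderiv ℝ r (x + e) = fderiv ℝ r x)

include he in
/-- `a[g(· + e)](x) = a[g](x + e)`. [folklore] -/
theorem invTT_comp_add (x : E4) : invTT t (fun y ↦ g (y + e)) x = invTT t g (x + e) := by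
  simp only [invTT, he]; rfl

include he hr in
/-- `b[g(· + e)](x) = b[g](x + e)`. [folklore] -/
theorem invTR_comp_add (x : E4) : invTR t r (fun y ↦ g (y + e)) x = invTR t r g (x + e) := by
  simp only [invTR, he, hr]; rfl

include hr in
/-- `c[g(· + e)](x) = c[g](x + e)`. [folklore] -/
theorem invRR_comp_add (x : E4) : invRR r (fun y ↦ g (y + e)) x = invRR r g (x + e) := by
  simp only [invRR, hr]; rfl

include he hr in
/-- `D[g(· + e)](x) = D[g](x + e)`. [folklore] -/
theorem discr_comp_add (x : E4) : discr t r (fun y ↦ g (y + e)) x = discr t r g (x + e) := by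
  simp only [discr, invTT_comp_add g he, invTR_comp_add g he hr, invRR_comp_add g hr]

include he hr in
/-- `θ_L[g(· + e)](x) = θ_L[g](x + e)`. [folklore] -/
theorem outConormal_comp_add (x : E4) :
    outConormal t r (fun y ↦ g (y + e)) x = outConormal t r g (x + e) := by
  simp only [outConormal, discr_comp_add g he hr, invTT_comp_add g he, invTR_comp_add g he hr, he,
    hr]

include he hr in
/-- `θ_N[g(· + e)](x) = θ_N[g](x + e)`. [folklore] -/
theorem inConormal_comp_add (x : E4) :
    inConormal t r (fun y ↦ g (y + e)) x = inConormal t r g (x + e) := by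
  simp only [inConormal, discr_comp_add g he hr, invTT_comp_add g he, invTR_comp_add g he hr, he,
    hr]

include he hr in
/-- **`L` is translation covariant**: `L[g(· + e)] = L[g](· + e)`. [cite: arXiv08110354, §5.1] -/
theorem outNull_comp_add : outNull t r (fun y ↦ g (y + e)) = fun x ↦ outNull t r g (x + e) := by
  funext x
  simp only [outNull, outConormal_comp_add g he hr]
  rfl

include he hr in
/-- **`N` is translation covariant**: `N[g(· + e)] = N[g](· + e)`. [cite: arXiv08110354, §5.1] -/
theorem inNull_comp_add : inNull t r (fun y ↦ g (y + e)) = fun x ↦ inNull t r g (x + e) := by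
  funext x
  simp only [inNull, inConormal_comp_add g he hr]
  rfl

include he hr in
/-- `q♯[g(· + e)](x) = q♯[g](x + e)`. [folklore] -/
theorem surfSharp_comp_add (x : E4) :
    surfSharp t r (fun y ↦ g (y + e)) x = surfSharp t r g (x + e) := by
  simp only [surfSharp, outNull_comp_add g he hr, inNull_comp_add g he hr]
  rfl

/-- The Lie derivative is translation covariant: `ℒ_{V(·+e)} g(·+e) (x) = (ℒ_V g)(x + e)`
(`fderiv_comp_add_right`). [folklore] -/
theorem lieDerivAt_comp_add (V : E4 → E4) (x : E4) :
    MetricCoord.lieDerivAt (fun y ↦ g (y + e)) (fun y ↦ V (y + e)) x =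
      MetricCoord.lieDerivAt g V (x + e) := by
  simp only [MetricCoord.lieDerivAt, fderiv_comp_add_right]

/-- The volume density is translation covariant: `√|det g(·+e)|(x) = √|det g|(x + e)`. [folklore] -/
theorem volDensity_comp_add (x : E4) :
    MetricCoord.volDensity (fun y ↦ g (y + e)) x = MetricCoord.volDensity g (x + e) :=
  rfl

include he hr in
/-- **The shear density is translation covariant**: `|σ_{V(·+e)}|²[g(·+e)](x) = |σ_V|²[g](x + e)`.
[cite: arXiv08110354, §5.1] -/
theorem shearSq_comp_add (V : E4 → E4) (x : E4) :
    shearSq t r (fun y ↦ g (y + e)) (fun y ↦ V (y + e)) x = shearSq t r g V (x + e) := by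
  simp only [shearSq, surfNormSq, surfTrace, surfSharp_comp_add g he hr, lieDerivAt_comp_add]

end Comp

end CoordSphere

/-! ### Smeared cylinder fluxes on a slab and the non-radiating condition -/

namespace ModelBackground

variable (B : ModelBackground)

/-- The **radial shell of the slab**: `S_L ∩ {ρ₁ < r < ρ₂} = {x ∈ U | τ₀ < t(x) < τ₀ + L, ρ₁ < r(x) < ρ₂}`
as a subset of `E4`, the smeared cylinder over which fluxes through `C_s = S_L ∩ {r = s}`,
`ρ₁ < s < ρ₂`, are integrated. [cite: arXiv08110354, §5.1] -/
def slabShell (τ₀ L ρ₁ ρ₂ : ℝ) : Set E4 :=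
  {x | x ∈ B.domain ∧ (τ₀ < B.time x ∧ B.time x < τ₀ + L) ∧ (ρ₁ < B.radius x ∧ B.radius x < ρ₂)}

/-- Membership in the radial shell of the slab. [cite: arXiv08110354, §5.1] -/
@[simp]
theorem mem_slabShell {τ₀ L ρ₁ ρ₂ : ℝ} {x : E4} :
    x ∈ B.slabShell τ₀ L ρ₁ ρ₂ ↔
      x ∈ B.domain ∧ (τ₀ < B.time x ∧ B.time x < τ₀ + L) ∧ (ρ₁ < B.radius x ∧ B.radius x < ρ₂) :=
  Iff.rfl

/-- The shells lie in the slab `S_L = val '' timeSlabIoo τ₀ L` (so a measure carried by `S_L × S³`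
sees all of them). [cite: HuneauLuk2024wave, Assumptions 1.2] -/
theorem slabShell_subset_image_timeSlabIoo (τ₀ L ρ₁ ρ₂ : ℝ) :
    B.slabShell τ₀ L ρ₁ ρ₂ ⊆ Subtype.val '' B.timeSlabIoo τ₀ L := fun x hx ↦
  ⟨⟨x, hx.1⟩, hx.2.1, rfl⟩

/-- Shells are monotone in the slab and in the radial interval. [folklore] -/
theorem slabShell_mono {τ₀ L τ₀' L' ρ₁ ρ₂ ρ₁' ρ₂' : ℝ} (h₁ : τ₀ ≤ τ₀') (h₂ : τ₀' + L' ≤ τ₀ + L)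
    (h₃ : ρ₁ ≤ ρ₁') (h₄ : ρ₂' ≤ ρ₂) : B.slabShell τ₀' L' ρ₁' ρ₂' ⊆ B.slabShell τ₀ L ρ₁ ρ₂ :=
  fun _ hx ↦ ⟨hx.1, ⟨h₁.trans_lt hx.2.1.1, hx.2.1.2.trans_le h₂⟩,
    ⟨h₃.trans_lt hx.2.2.1, hx.2.2.2.trans_le h₄⟩⟩

variable (τ₀ L : ℝ) (g : E4 → E4 →L[ℝ] E4 →L[ℝ] ℝ)
  (μ : Measure (E4 × Metric.sphere (0 : E4) 1))

/-- The **smeared focusing flux** of the vector field `V` (a null normal field of the coordinate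
spheres) through the cylinders `C_s = S_L ∩ {r = s}`, `ρ₁ < s < ρ₂`, of the limit pair `(g, μ)`:

  `𝔉_V(ρ₁, ρ₂) = ∫_{shell} √D · |σ_V|²_q · √|det g| dx + ∫_{shell × S³} √D(x) ⟪ω, V x⟫² dμ(x, ω) ∈ [0, ∞]`,

the two source terms `σ_{ab}σ^{ab} + R_{ab}V^aV^b` of the Raychaudhuri equation of `V` (Hawking–Ellis
(4.35); Ashtekar–Krishnan 2004, §2.1.1) — the second through the Einstein–massless-Vlasov equation
of Burnett limits, `Ric(V,V) dVol_g = ⟪ω,V⟫² μ` (Huneau–Luk arXiv:2403.03470, Thm. 1.5 (2); the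
effective stress tensor `T = ∫ ω ⊗ ω dμ_x`, arXiv:1907.10743, Rem. 4.3) — integrated against
`√D dVol_g = dt ∧ dr ∧ dA_q`, so that `𝔉_V(ρ₁, ρ₂) = ∫_{ρ₁}^{ρ₂} (∫_{C_s} (|σ_V|² + T(V,V)) dA_q dt) ds`.
Lower integrals of `ENNReal.ofReal`: no integrability junk. [cite: AshtekarKrishnan2004, §2.1.1 and §3.3] -/
def focusingFlux (V : E4 → E4) (ρ₁ ρ₂ : ℝ) : ℝ≥0∞ :=
  (∫⁻ x in B.slabShell τ₀ L ρ₁ ρ₂,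
      ENNReal.ofReal (Real.sqrt (CoordSphere.discr B.time B.radius g x) *
        (CoordSphere.shearSq B.time B.radius g V x * MetricCoord.volDensity g x))) +
    ∫⁻ p in B.slabShell τ₀ L ρ₁ ρ₂ ×ˢ (univ : Set (Metric.sphere (0 : E4) 1)),
      ENNReal.ofReal (Real.sqrt (CoordSphere.discr B.time B.radius g p.1) *
        ⟪(p.2 : E4), V p.1⟫ ^ 2) ∂μ

/-- The **smeared outgoing radiative flux** `𝔉_N(ρ₁, ρ₂)` of `(g, μ)` through the cylinders
`S_L ∩ {r = s}`, `ρ₁ < s < ρ₂`: the focusing flux of the INGOING null normal `N`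
(`CoordSphere.inNull`), whose shear carries the news at null infinity (`r χ̲̂ → −2Ξ`,
`∂_u M = (8π)⁻¹ ∮ |Ξ|²`: Christodoulou–Klainerman 1993, Ch. 17, (17.0.7) and Conclusion 17.0.4; the
Bondi–Sachs mass-loss formula) and whose kinetic part `T(N, N)` is the outgoing null-matter flux.
[cite: ChristodoulouKlainerman1993, Ch. 17, (17.0.7)] -/
def outgoingFlux (ρ₁ ρ₂ : ℝ) : ℝ≥0∞ :=
  B.focusingFlux τ₀ L g μ (CoordSphere.inNull B.time B.radius g) ρ₁ ρ₂

/-- The **smeared ingoing radiative flux** `𝔉_L(ρ₁, ρ₂)` of `(g, μ)`: the focusing flux of the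
OUTGOING null normal `L` (`CoordSphere.outNull`) — on a horizon generated by `ℓ` the terms
`|σ|² + 4π T_{ab}ℓ^aℓ^b` drive the area increase (Hawking–Hartle 1972, (5), (12)–(14)), and they
vanish iff the horizon is non-expanding, i.e. in equilibrium (Ashtekar–Krishnan 2004, §2.1.1).
[cite: HawkingHartle1972, (5), (12)–(14)] -/
def ingoingFlux (ρ₁ ρ₂ : ℝ) : ℝ≥0∞ :=
  B.focusingFlux τ₀ L g μ (CoordSphere.outNull B.time B.radius g) ρ₁ ρ₂

/-- **The slab is adapted to the components `g`**: on `S_L` the slab time is a time function for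
`g`, `a = g⁻¹(dt, dt) < 0` (`dt` timelike; for uniformly non-degenerate limits `g^{tt} ≤ −c`, the
crux's hypothesis T1), and the coordinate spheres `S_{t,ρ}` have timelike `g`-normal planes,
`D = b² − ac > 0` — automatic for spacelike `2`-surfaces of a Lorentzian metric, in particular for
spheres inside the spacelike slices `{t = const}`. Then the null normals `L`, `N` exist, are
future-directed and lapse-normalised (`CoordSphere.fderiv_time_outNull/inNull`,
`….apply_outNull_outNull`). The condition excludes the junk regime `D ≤ 0` (e.g. Riemannian
components), where all focusing fluxes vanish identically. [cite: AshtekarKrishnan2004, §2.1.1] -/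
structure IsAdaptedSlab (B : ModelBackground) (τ₀ L : ℝ) (g : E4 → E4 →L[ℝ] E4 →L[ℝ] ℝ) : Prop where
  /-- the slab time is a `g`-time function: `g⁻¹(dt, dt) < 0` on `S_L`. -/
  invTT_neg : ∀ x ∈ Subtype.val '' B.timeSlabIoo τ₀ L, CoordSphere.invTT B.time g x < 0
  /-- the coordinate spheres have timelike normal planes: `D > 0` on `S_L`. -/
  discr_pos : ∀ x ∈ Subtype.val '' B.timeSlabIoo τ₀ L, 0 < CoordSphere.discr B.time B.radius g x

/-- Adaptedness persists on sub-slabs. [folklore] -/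
theorem IsAdaptedSlab.anti {B : ModelBackground} {τ₀ L τ₀' L' : ℝ} {g : E4 → E4 →L[ℝ] E4 →L[ℝ] ℝ}
    (h : B.IsAdaptedSlab τ₀ L g) (h₁ : τ₀ ≤ τ₀') (h₂ : τ₀' + L' ≤ τ₀ + L) :
    B.IsAdaptedSlab τ₀' L' g := by
  have hsub : Subtype.val '' B.timeSlabIoo τ₀' L' ⊆ Subtype.val '' B.timeSlabIoo τ₀ L :=
    image_mono fun y hy ↦ ⟨h₁.trans_lt hy.1, hy.2.trans_le (by linarith)⟩
  exact ⟨fun x hx ↦ h.invTT_neg x (hsub hx), fun x hx ↦ h.discr_pos x (hsub hx)⟩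

/-- **`(g, μ)` is a non-radiating limit pair on the slab `S_L = {τ₀ < t < τ₀ + L}` of `B`, with inner
end at `r = r_in`** (flux form, Lipschitz regularity): (o) the slab is adapted to `g`
(`IsAdaptedSlab`: `dt` timelike, coordinate spheres with timelike normal planes, on `S_L`);
(i) OUTGOING — the smeared outgoing radiative flux through the far cylinders vanishes in the Bondi
limit, `𝔉_N(R, R + 1) → 0` as `R → ∞` (no news and no outgoing null matter leave through the far end:
Bondi–van der Burg–Metzner 1962 / Sachs 1962, Christodoulou–Klainerman 1993, Conclusion 17.0.4);
(ii) INGOING — the averaged ingoing radiative flux through the inner cylinders vanishes at the inner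
end, `(ρ − r_in)⁻¹ 𝔉_L(r_in, ρ) → 0` as `ρ ↓ r_in` (the inner end is a non-expanding horizon end:
no shear and no null matter cross it, Hawking–Hartle 1972; Ashtekar–Krishnan 2004, §2.1.1, Def. 1).
A route-posited notion assembled from these sources; no single printed definition exists at this
regularity (module docstring). [cite: AshtekarKrishnan2004, §2.1.1 Def. 1 and §3.3] -/
structure IsNonRadiatingLimit (B : ModelBackground) (rIn τ₀ L : ℝ) (g : E4 → E4 →L[ℝ] E4 →L[ℝ] ℝ)
    (μ : Measure (E4 × Metric.sphere (0 : E4) 1)) : Prop where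
  /-- (o) the slab is adapted to `g`: `dt` timelike and the coordinate spheres spacelike with timelike
  normal planes on `S_L` (so the fluxes below are not junk). -/
  isAdaptedSlab : B.IsAdaptedSlab τ₀ L g
  /-- (i) no outgoing radiation through the far end: `𝔉_N(R, R+1) → 0` as `R → ∞`. -/
  tendsto_outgoingFlux : Tendsto (fun R ↦ B.outgoingFlux τ₀ L g μ R (R + 1)) atTop (𝓝 0)
  /-- (ii) no ingoing radiation through the inner end: `(ρ − r_in)⁻¹ 𝔉_L(r_in, ρ) → 0` as `ρ ↓ r_in`. -/
  tendsto_ingoingFlux : Tendsto (fun ρ ↦ (ENNReal.ofReal (ρ - rIn))⁻¹ * B.ingoingFlux τ₀ L g μ rIn ρ)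
    (𝓝[>] rIn) (𝓝 0)

variable {B τ₀ L g μ}

/-- The focusing flux is monotone in the shell. [folklore] -/
theorem focusingFlux_mono {τ₀' L' : ℝ} (V : E4 → E4) {ρ₁ ρ₂ ρ₁' ρ₂' : ℝ}
    (h : B.slabShell τ₀' L' ρ₁' ρ₂' ⊆ B.slabShell τ₀ L ρ₁ ρ₂) :
    B.focusingFlux τ₀' L' g μ V ρ₁' ρ₂' ≤ B.focusingFlux τ₀ L g μ V ρ₁ ρ₂ :=
  add_le_add (lintegral_mono_set h) (lintegral_mono_set (prod_mono h Subset.rfl))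

/-- **Without defect measure only the shear term remains**: for `μ = 0`,
`𝔉_V(ρ₁, ρ₂) = ∫_{shell} √D |σ_V|²_q √|det g| dx`. [cite: AshtekarKrishnan2004, §3.3] -/
theorem focusingFlux_zero_measure (V : E4 → E4) (ρ₁ ρ₂ : ℝ) :
    B.focusingFlux τ₀ L g 0 V ρ₁ ρ₂ =
      ∫⁻ x in B.slabShell τ₀ L ρ₁ ρ₂,
        ENNReal.ofReal (Real.sqrt (CoordSphere.discr B.time B.radius g x) *
          (CoordSphere.shearSq B.time B.radius g V x * MetricCoord.volDensity g x)) := by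
  simp [focusingFlux]

namespace IsNonRadiatingLimit

/-- **Sub-slabs of a non-radiating slab are non-radiating**: if `{τ₀' < t < τ₀' + L'} ⊆ {τ₀ < t < τ₀ + L}`
then the fluxes only decrease. [folklore] -/
theorem anti {rIn τ₀' L' : ℝ} (h : B.IsNonRadiatingLimit rIn τ₀ L g μ) (h₁ : τ₀ ≤ τ₀')
    (h₂ : τ₀' + L' ≤ τ₀ + L) : B.IsNonRadiatingLimit rIn τ₀' L' g μ where
  isAdaptedSlab := h.isAdaptedSlab.anti h₁ h₂
  tendsto_outgoingFlux :=
    tendsto_of_tendsto_of_tendsto_of_le_of_le tendsto_const_nhds h.tendsto_outgoingFlux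
      (fun _ ↦ bot_le) fun _ ↦
        focusingFlux_mono _ (B.slabShell_mono h₁ h₂ le_rfl le_rfl)
  tendsto_ingoingFlux :=
    tendsto_of_tendsto_of_tendsto_of_le_of_le tendsto_const_nhds h.tendsto_ingoingFlux
      (fun _ ↦ bot_le) fun _ ↦ by
        dsimp only
        gcongr
        exact focusingFlux_mono _ (B.slabShell_mono h₁ h₂ le_rfl le_rfl)

/-- Shorter slabs with the same start inherit the non-radiating property. [folklore] -/
theorem mono_length {rIn L' : ℝ} (h : B.IsNonRadiatingLimit rIn τ₀ L g μ) (hL : L' ≤ L) :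
    B.IsNonRadiatingLimit rIn τ₀ L' g μ :=
  h.anti le_rfl (by linarith)

end IsNonRadiatingLimit

/-! #### Time-translation covariance on a stationary background

For a stationary background (`ModelBackground.IsStationary`: `U + T∂₀ = U`, `t(x + T∂₀) = t(x) + T`,
`r(x + T∂₀) = r(x)`) reading the translated pair `(g(· + T∂₀), μ(· + T∂₀))` on the slab `S_L(τ₀)` is
the same as reading `(g, μ)` on `S_L(τ₀ + T)`: the fluxes, hence the non-radiating condition, are
covariant under the residual time-translation gauge of late-time limits (the translates
`Spacetime.translatedChartMetric`, Dafermos–Rodnianski arXiv:0811.0354, §5.1). -/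

section TimeShift

/-- Translation of the base point of the cosphere bundle `E4 × S³` by `e`, `(x, ω) ↦ (x + e, ω)`, as a
measurable equivalence (the fibre is untouched: `d(x ↦ x + e) = id`). [folklore] -/
def cosphereShift (e : E4) :
    E4 × Metric.sphere (0 : E4) 1 ≃ᵐ E4 × Metric.sphere (0 : E4) 1 :=
  (MeasurableEquiv.addRight e).prodCongr (MeasurableEquiv.refl _)

/-- `cosphereShift e (x, ω) = (x + e, ω)`. [folklore] -/
@[simp]
theorem cosphereShift_apply (e : E4) (p : E4 × Metric.sphere (0 : E4) 1) :
    cosphereShift e p = (p.1 + e, p.2) :=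
  rfl

/-- Change of variables `y = x + e` in a lower integral over a shell (translation invariance of
Lebesgue measure; no measurability needed). [folklore] -/
private theorem setLIntegral_preimage_add_right (e : E4) (f : E4 → ℝ≥0∞) (S : Set E4) :
    ∫⁻ x in (fun x ↦ x + e) ⁻¹' S, f (x + e) = ∫⁻ y in S, f y := by
  have hc : ⇑(MeasurableEquiv.addRight e) = fun x : E4 ↦ x + e := MeasurableEquiv.coe_addRight e
  calc ∫⁻ x in (fun x ↦ x + e) ⁻¹' S, f (x + e)
      = ∫⁻ x, f (MeasurableEquiv.addRight e x)
          ∂(volume.restrict (MeasurableEquiv.addRight e ⁻¹' S)) := by rw [hc]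
    _ = ∫⁻ y, f y ∂((volume.restrict (MeasurableEquiv.addRight e ⁻¹' S)).map
          (MeasurableEquiv.addRight e)) := (lintegral_map_equiv f _).symm
    _ = ∫⁻ y in S, f y := by
        rw [← (MeasurableEquiv.addRight e).measurableEmbedding.restrict_map, hc,
          map_add_right_eq_self]

/-- Change of variables `y = x + e` in a lower integral over `shell × S³` against the translated
measure `μ(· + e) = map (cosphereShift (−e)) μ`. [folklore] -/
private theorem setLIntegral_prod_preimage_add_right (e : E4)
    (F : E4 × Metric.sphere (0 : E4) 1 → ℝ≥0∞) (S : Set E4)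
    (μ : Measure (E4 × Metric.sphere (0 : E4) 1)) :
    ∫⁻ p in ((fun x ↦ x + e) ⁻¹' S) ×ˢ (univ : Set (Metric.sphere (0 : E4) 1)), F (p.1 + e, p.2)
        ∂(μ.map (cosphereShift (-e))) =
      ∫⁻ q in S ×ˢ (univ : Set (Metric.sphere (0 : E4) 1)), F q ∂μ := by
  have hpre : cosphereShift (-e) ⁻¹'
      (((fun x ↦ x + e) ⁻¹' S) ×ˢ (univ : Set (Metric.sphere (0 : E4) 1))) = S ×ˢ univ := by
    ext q
    simp
  rw [(cosphereShift (-e)).measurableEmbedding.restrict_map, hpre, lintegral_map_equiv]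
  refine lintegral_congr fun q ↦ ?_
  simp

variable {B : ModelBackground} {τ₀ L : ℝ} {g : E4 → E4 →L[ℝ] E4 →L[ℝ] ℝ}
  {μ : Measure (E4 × Metric.sphere (0 : E4) 1)}

/-- On a stationary background the shell of the slab `S_L(τ₀ + T)` is the `T∂₀`-translate of the
shell of `S_L(τ₀)`. [cite: arXiv08110354, §5.1] -/
theorem preimage_add_slabShell (hB : B.IsStationary) (T τ₀ L ρ₁ ρ₂ : ℝ) :
    (fun x : E4 ↦ x + T • E4.basisVector 0) ⁻¹' B.slabShell (τ₀ + T) L ρ₁ ρ₂ =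
      B.slabShell τ₀ L ρ₁ ρ₂ := by
  ext x
  simp only [mem_preimage, mem_slabShell, hB.add_mem_iff, hB.time_add, hB.radius_add]
  constructor
  · rintro ⟨h0, ⟨h1, h2⟩, h3⟩
    exact ⟨h0, ⟨by linarith, by linarith⟩, h3⟩
  · rintro ⟨h0, ⟨h1, h2⟩, h3⟩
    exact ⟨h0, ⟨by linarith, by linarith⟩, h3⟩

/-- The slab time of a stationary background has translation-invariant differential. [folklore] -/
theorem IsStationary.fderiv_time_add (hB : B.IsStationary) (T : ℝ) (x : E4) :
    fderiv ℝ B.time (x + T • E4.basisVector 0) = fderiv ℝ B.time x := by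
  rw [← fderiv_comp_add_right (f := B.time) (T • E4.basisVector 0)]
  have h : (fun y : E4 ↦ B.time (y + T • E4.basisVector 0)) = fun y ↦ B.time y + T :=
    funext (hB.time_add T)
  rw [h, fderiv_add_const]

/-- The radius of a stationary background has translation-invariant differential. [folklore] -/
theorem IsStationary.fderiv_radius_add (hB : B.IsStationary) (T : ℝ) (x : E4) :
    fderiv ℝ B.radius (x + T • E4.basisVector 0) = fderiv ℝ B.radius x := by
  rw [← fderiv_comp_add_right (f := B.radius) (T • E4.basisVector 0)]
  have h : (fun y : E4 ↦ B.radius (y + T • E4.basisVector 0)) = B.radius :=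
    funext (hB.radius_add T)
  rw [h]

/-- **Time-translation covariance of the focusing flux** on a stationary background: the flux of
the translated pair `(g(· + T∂₀), μ(· + T∂₀))` and translated field `V(· + T∂₀)` through the shells
of `S_L(τ₀)` is the flux of `(g, μ, V)` through the shells of `S_L(τ₀ + T)`. [cite: arXiv08110354, §5.1] -/
theorem focusingFlux_timeShift (hB : B.IsStationary) (T : ℝ) (V : E4 → E4) (ρ₁ ρ₂ : ℝ) :
    B.focusingFlux τ₀ L (fun x ↦ g (x + T • E4.basisVector 0))
        (μ.map (cosphereShift (-(T • E4.basisVector 0)))) (fun x ↦ V (x + T • E4.basisVector 0))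
        ρ₁ ρ₂ =
      B.focusingFlux (τ₀ + T) L g μ V ρ₁ ρ₂ := by
  have he := hB.fderiv_time_add T
  have hr := hB.fderiv_radius_add T
  simp only [focusingFlux, CoordSphere.discr_comp_add g he hr, CoordSphere.shearSq_comp_add g he hr,
    CoordSphere.volDensity_comp_add g]
  rw [← preimage_add_slabShell hB T τ₀ L ρ₁ ρ₂]
  congr 1
  · exact setLIntegral_preimage_add_right (T • E4.basisVector 0)
      (fun y ↦ ENNReal.ofReal (Real.sqrt (CoordSphere.discr B.time B.radius g y) *
        (CoordSphere.shearSq B.time B.radius g V y * MetricCoord.volDensity g y))) _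
  · exact setLIntegral_prod_preimage_add_right (T • E4.basisVector 0)
      (fun q ↦ ENNReal.ofReal (Real.sqrt (CoordSphere.discr B.time B.radius g q.1) *
        ⟪(q.2 : E4), V q.1⟫ ^ 2)) _ μ

/-- **Time-translation covariance of the outgoing flux** (stationary background).
[cite: arXiv08110354, §5.1] -/
theorem outgoingFlux_timeShift (hB : B.IsStationary) (T ρ₁ ρ₂ : ℝ) :
    B.outgoingFlux τ₀ L (fun x ↦ g (x + T • E4.basisVector 0))
        (μ.map (cosphereShift (-(T • E4.basisVector 0)))) ρ₁ ρ₂ =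
      B.outgoingFlux (τ₀ + T) L g μ ρ₁ ρ₂ := by
  rw [outgoingFlux, outgoingFlux,
    CoordSphere.inNull_comp_add g (hB.fderiv_time_add T) (hB.fderiv_radius_add T)]
  exact focusingFlux_timeShift hB T _ ρ₁ ρ₂

/-- **Time-translation covariance of the ingoing flux** (stationary background).
[cite: arXiv08110354, §5.1] -/
theorem ingoingFlux_timeShift (hB : B.IsStationary) (T ρ₁ ρ₂ : ℝ) :
    B.ingoingFlux τ₀ L (fun x ↦ g (x + T • E4.basisVector 0))
        (μ.map (cosphereShift (-(T • E4.basisVector 0)))) ρ₁ ρ₂ =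
      B.ingoingFlux (τ₀ + T) L g μ ρ₁ ρ₂ := by
  rw [ingoingFlux, ingoingFlux,
    CoordSphere.outNull_comp_add g (hB.fderiv_time_add T) (hB.fderiv_radius_add T)]
  exact focusingFlux_timeShift hB T _ ρ₁ ρ₂

/-- Adaptedness is covariant under time translations of a stationary background. [cite: arXiv08110354, §5.1] -/
theorem isAdaptedSlab_timeShift_iff (hB : B.IsStationary) (T : ℝ) :
    B.IsAdaptedSlab τ₀ L (fun x ↦ g (x + T • E4.basisVector 0)) ↔ B.IsAdaptedSlab (τ₀ + T) L g := by
  have he := hB.fderiv_time_add T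
  have hr := hB.fderiv_radius_add T
  have hmem : ∀ y : E4, y ∈ Subtype.val '' B.timeSlabIoo (τ₀ + T) L ↔
      y - T • E4.basisVector 0 ∈ Subtype.val '' B.timeSlabIoo τ₀ L := fun y ↦ by
    rw [← hB.image_add_timeSlabIoo T τ₀ L]
    constructor
    · rintro ⟨x, hx, rfl⟩
      simpa using hx
    · intro hy
      exact ⟨y - T • E4.basisVector 0, hy, sub_add_cancel y _⟩
  constructor
  · intro h
    refine ⟨fun y hy ↦ ?_, fun y hy ↦ ?_⟩
    · have h1 := h.invTT_neg _ ((hmem y).1 hy)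
      rwa [CoordSphere.invTT_comp_add g he, sub_add_cancel] at h1
    · have h1 := h.discr_pos _ ((hmem y).1 hy)
      rwa [CoordSphere.discr_comp_add g he hr, sub_add_cancel] at h1
  · intro h
    refine ⟨fun x hx ↦ ?_, fun x hx ↦ ?_⟩
    · rw [CoordSphere.invTT_comp_add g he]
      exact h.invTT_neg _ ((hmem _).2 (by simpa using hx))
    · rw [CoordSphere.discr_comp_add g he hr]
      exact h.discr_pos _ ((hmem _).2 (by simpa using hx))

/-- **The non-radiating condition is covariant under the residual time-translation gauge**: on a
stationary background, the translated pair `(g(· + T∂₀), μ(· + T∂₀))` is non-radiating on `S_L(τ₀)`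
iff `(g, μ)` is non-radiating on `S_L(τ₀ + T)` (same inner radius). [cite: arXiv08110354, §5.1] -/
theorem isNonRadiatingLimit_timeShift_iff (hB : B.IsStationary) (rIn T : ℝ) :
    B.IsNonRadiatingLimit rIn τ₀ L (fun x ↦ g (x + T • E4.basisVector 0))
        (μ.map (cosphereShift (-(T • E4.basisVector 0)))) ↔
      B.IsNonRadiatingLimit rIn (τ₀ + T) L g μ := by
  constructor
  · intro h
    exact ⟨(isAdaptedSlab_timeShift_iff hB T).1 h.isAdaptedSlab,
      by simpa only [outgoingFlux_timeShift hB] using h.tendsto_outgoingFlux,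
      by simpa only [ingoingFlux_timeShift hB] using h.tendsto_ingoingFlux⟩
  · intro h
    exact ⟨(isAdaptedSlab_timeShift_iff hB T).2 h.isAdaptedSlab,
      by simpa only [outgoingFlux_timeShift hB] using h.tendsto_outgoingFlux,
      by simpa only [ingoingFlux_timeShift hB] using h.tendsto_ingoingFlux⟩

end TimeShift

end ModelBackground

/-! ### The Kerr–Schild instance -/

namespace Kerr

/-- **Non-radiating limit pairs on Kerr–Schild slabs**: `IsNonRadiatingLimit` for the Kerr reference
background `(Kerr.exterior M a, g_{M,a}, t*, r)` in ingoing Kerr–Schild coordinates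
(`Kerr.background`), whose slabs `{τ₀ < t* < τ₀ + L, r > max r₊ 0}` have the future event horizon
`{r = r₊}` as inner end (`r_in = max (rPlus M a) 0`, the infimum of `r` over `Kerr.exterior`) — the
form requested by route BurnettKineticRigidity for late-time Burnett ω-limits with defect measure
(`Spacetime.lateTimeBurnettDefectOmegaLimitSet 𝓢 (Kerr.background M a) Ψ τ₀ L`).
[cite: AshtekarKrishnan2004, §2.1.1 Def. 1 and §3.3] -/
def IsNonRadiatingLimit (M a τ₀ L : ℝ) (g : E4 → E4 →L[ℝ] E4 →L[ℝ] ℝ)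
    (μ : Measure (E4 × Metric.sphere (0 : E4) 1)) : Prop :=
  (Kerr.background M a).IsNonRadiatingLimit (max (rPlus M a) 0) τ₀ L g μ

/-- Unfolding lemma for the Kerr instance. [folklore] -/
theorem isNonRadiatingLimit_iff {M a τ₀ L : ℝ} {g : E4 → E4 →L[ℝ] E4 →L[ℝ] ℝ}
    {μ : Measure (E4 × Metric.sphere (0 : E4) 1)} :
    Kerr.IsNonRadiatingLimit M a τ₀ L g μ ↔
      (Kerr.background M a).IsNonRadiatingLimit (max (rPlus M a) 0) τ₀ L g μ :=
  Iff.rfl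

/-- On the Kerr background the slab time is the coordinate `t* = x⁰`, so `dt = dx⁰` everywhere
(Dafermos–Rodnianski arXiv:0811.0354, §5.1). [cite: arXiv08110354, §5.1] -/
theorem fderiv_background_time (M a : ℝ) (x : E4) :
    fderiv ℝ (Kerr.background M a).time x = E4.dx 0 := by
  have h : (Kerr.background M a).time = ⇑(E4.dx 0) := rfl
  rw [h, ContinuousLinearMap.fderiv]

/-- The Kerr–Schild slab shells are the coordinate regions
`{max r₊ 0 < r, τ₀ < x⁰ < τ₀ + L, ρ₁ < r < ρ₂}` of `E4`. [cite: arXiv08110354, §5.1] -/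
theorem mem_slabShell_background {M a τ₀ L ρ₁ ρ₂ : ℝ} {x : E4} :
    x ∈ (Kerr.background M a).slabShell τ₀ L ρ₁ ρ₂ ↔
      max (rPlus M a) 0 < radius a x ∧ (τ₀ < x 0 ∧ x 0 < τ₀ + L) ∧
        (ρ₁ < radius a x ∧ radius a x < ρ₂) := by
  simp [ModelBackground.slabShell, Kerr.background]

end Kerr

/-! ### Minkowski components: the null normals of the round coordinate spheres

For constant components `η` with slab time `x⁰` and radius `|x̲|` (the background
`Kerr.background 0 0`, i.e. `Minkowski` minus the time axis) everything is explicit: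
`♯dx⁰ = −∂₀`, `♯d|x̲| = r̂ = (0, x̲/|x̲|)` (`Minkowski.radialUnit`), `a = −1`, `b = 0`, `c = 1`,
`D = 1`, and the null normals of the round spheres `{x⁰ = t, |x̲| = ρ}` are
`L = ∂₀ + r̂ = Minkowski.outgoingNull`, `N = ∂₀ − r̂ = Minkowski.ingoingNull` (the flat null frame
of `RecedingKerrInitialLayerNorm.lean`, Dafermos–Rodnianski arXiv:0910.4957, §3), as asserted in the
docstrings above; moreover `D r̂ = |x̲|⁻¹ Π` with `Π` the tangential projector, `ℒ_N η = −(2/|x̲|) η(Π·,·)`,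
`ℒ_L η = +(2/|x̲|) η(Π·,·)` are pure trace on the round spheres, so BOTH SHEARS VANISH and
`(η, 0)` is a non-radiating limit pair (`Kerr.isNonRadiatingLimit_minkowski`). -/

namespace CoordSphere

/-- `r̂⁰ = 0` for the radial unit vector field `r̂ = (0, x̲/|x̲|)` (`Minkowski.radialUnit` of
`RecedingKerrInitialLayerNorm.lean`, reused). [folklore] -/
@[simp]
theorem _root_.Literature.Geometry.Lorentzian.Minkowski.radialUnit_apply_zero (x : E4) :
    Minkowski.radialUnit x 0 = 0 := rfl

/-- `r̂ⁱ = xⁱ/|x̲|`. [folklore] -/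
@[simp]
theorem _root_.Literature.Geometry.Lorentzian.Minkowski.radialUnit_apply_succ (x : E4) (i : Fin 3) :
    Minkowski.radialUnit x i.succ = (E4.spatialNorm x)⁻¹ * x i.succ := by
  simp [Minkowski.radialUnit]

/-- `η` is invertible as a map `E4 → E4*`. [folklore] -/
theorem isInvertible_minkowski : (Minkowski.bilin).IsInvertible :=
  MetricCoord.isInvertible_of_nondegenerate Minkowski.bilin_nondegenerate

/-- `♯_η dx⁰ = −∂₀`. [folklore] -/
theorem sharpAt_minkowski_dx_zero (x : E4) :
    MetricCoord.sharpAt (fun _ : E4 ↦ Minkowski.bilin) x (E4.dx 0) = -E4.basisVector 0 :=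
  MetricCoord.sharpAt_eq_of_forall (G := fun _ : E4 ↦ Minkowski.bilin) isInvertible_minkowski
    fun w ↦ by
      rw [map_neg, _root_.neg_apply, Minkowski.bilin_basisVector_zero_left, neg_neg]
      rfl

/-- **The differential of the spatial radius** off the time axis:
`d|x̲|(w) = ⟪x̲, w̲⟫/|x̲|`. [folklore] -/
theorem hasFDerivAt_spatialNorm {x : E4} (hx : E4.spatial x ≠ 0) :
    HasFDerivAt E4.spatialNorm
      ((E4.spatialNorm x)⁻¹ • (innerSL ℝ (E4.spatial x)).comp E4.spatial) x := by
  have h0 : 0 < ‖E4.spatial x‖ := norm_pos_iff.2 hx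
  have h1 : HasFDerivAt (fun y : E4 ↦ ‖E4.spatial y‖ ^ 2)
      ((2 • innerSL ℝ (E4.spatial x)).comp E4.spatial) x :=
    (hasStrictFDerivAt_norm_sq _).hasFDerivAt.comp x E4.spatial.hasFDerivAt
  have h2 : HasDerivAt Real.sqrt (1 / (2 * Real.sqrt (‖E4.spatial x‖ ^ 2))) (‖E4.spatial x‖ ^ 2) :=
    Real.hasDerivAt_sqrt (by positivity)
  have h3 := h2.comp_hasFDerivAt x h1
  have hf : (Real.sqrt ∘ fun y : E4 ↦ ‖E4.spatial y‖ ^ 2) = E4.spatialNorm := by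
    funext y
    simp [E4.spatialNorm, Real.sqrt_sq (norm_nonneg _)]
  rw [hf, Real.sqrt_sq h0.le] at h3
  refine h3.congr_fderiv ?_
  ext w
  simp only [_root_.smul_apply, ContinuousLinearMap.comp_apply, smul_eq_mul, nsmul_eq_mul,
    Nat.cast_ofNat, E4.spatialNorm]
  field_simp

/-- `d|x̲| = |x̲|⁻¹ ⟪x̲, ·̲⟫` off the time axis. [folklore] -/
theorem fderiv_spatialNorm {x : E4} (hx : E4.spatial x ≠ 0) :
    fderiv ℝ E4.spatialNorm x = (E4.spatialNorm x)⁻¹ • (innerSL ℝ (E4.spatial x)).comp E4.spatial :=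
  (hasFDerivAt_spatialNorm hx).fderiv

/-- `d|x̲|(w) = |x̲|⁻¹ Σᵢ xⁱ wⁱ`. [folklore] -/
theorem fderiv_spatialNorm_apply {x : E4} (hx : E4.spatial x ≠ 0) (w : E4) :
    fderiv ℝ E4.spatialNorm x w = (E4.spatialNorm x)⁻¹ * ∑ i : Fin 3, x i.succ * w i.succ := by
  rw [fderiv_spatialNorm hx, _root_.smul_apply, ContinuousLinearMap.comp_apply, innerSL_apply_apply,
    smul_eq_mul, EuclideanSpace.inner_eq_star_dotProduct]
  simp [dotProduct, Fin.sum_univ_three, mul_comm]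

/-- `♯_η d|x̲| = r̂` off the time axis. [folklore] -/
theorem sharpAt_minkowski_fderiv_spatialNorm {x : E4} (hx : E4.spatial x ≠ 0) :
    MetricCoord.sharpAt (fun _ : E4 ↦ Minkowski.bilin) x (fderiv ℝ E4.spatialNorm x) =
      Minkowski.radialUnit x :=
  MetricCoord.sharpAt_eq_of_forall (G := fun _ : E4 ↦ Minkowski.bilin) isInvertible_minkowski
    fun w ↦ by
      rw [fderiv_spatialNorm_apply hx, Minkowski.bilin_apply]
      simp [Finset.mul_sum, mul_assoc]

/-! #### The flat background `Kerr.background 0 0` with constant components `η` -/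

section Flat

variable {x : E4}

/-- For `a = 0` the Kerr–Schild radius of the background is the spatial radius `|x̲|`
(`Kerr.radius_zero_left`; Visser arXiv:0706.0622, (35)). [cite: arXiv07060622, (35)] -/
private theorem radius_background_zero : (Kerr.background 0 0).radius = E4.spatialNorm :=
  funext Kerr.radius_zero_left

/-- `a = η⁻¹(dx⁰, dx⁰) = −1`. [folklore] -/
theorem invTT_flat (x : E4) :
    invTT (Kerr.background 0 0).time (fun _ ↦ Minkowski.bilin) x = -1 := by
  rw [invTT, Kerr.fderiv_background_time, sharpAt_minkowski_dx_zero, map_neg]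
  simp

/-- `b = η⁻¹(dx⁰, d|x̲|) = 0` off the time axis. [folklore] -/
theorem invTR_flat (hx : E4.spatial x ≠ 0) :
    invTR (Kerr.background 0 0).time (Kerr.background 0 0).radius (fun _ ↦ Minkowski.bilin) x = 0 := by
  rw [invTR, Kerr.fderiv_background_time, radius_background_zero,
    sharpAt_minkowski_fderiv_spatialNorm hx]
  exact Minkowski.radialUnit_apply_zero x

/-- `c = η⁻¹(d|x̲|, d|x̲|) = |∇|x̲||² = 1` off the time axis. [folklore] -/
theorem invRR_flat (hx : E4.spatial x ≠ 0) :
    invRR (Kerr.background 0 0).radius (fun _ ↦ Minkowski.bilin) x = 1 := by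
  have h0 : E4.spatialNorm x ≠ 0 := (norm_pos_iff.2 hx).ne'
  have hsq := E4.spatialNorm_sq x
  rw [invRR, radius_background_zero, sharpAt_minkowski_fderiv_spatialNorm hx,
    fderiv_spatialNorm_apply hx]
  simp only [Fin.sum_univ_three, Minkowski.radialUnit_apply_succ]
  field_simp
  simp only [Fin.succ_zero_eq_one, Fin.succ_one_eq_two,
    show (Fin.succ (2 : Fin 3)) = (3 : Fin 4) from rfl] at *
  linarith [hsq]

/-- `D = b² − ac = 1` off the time axis: the round spheres are spacelike with timelike normal
plane. [folklore] -/
theorem discr_flat (hx : E4.spatial x ≠ 0) :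
    discr (Kerr.background 0 0).time (Kerr.background 0 0).radius (fun _ ↦ Minkowski.bilin) x = 1 := by
  rw [discr, invTT_flat, invTR_flat hx, invRR_flat hx]
  norm_num

/-- **`L = ∂₀ + r̂` for Minkowski components**: the outgoing null normal of the round sphere
`{x⁰ = t, |x̲| = ρ}` is the outgoing null vector `∂_t + ∂_r` of Minkowski space
(`Minkowski.outgoingNull`, Dafermos–Rodnianski's `L`), as asserted. [cite: DafermosRodnianski2010ICMP, §3] -/
theorem outNull_flat (hx : E4.spatial x ≠ 0) :
    outNull (Kerr.background 0 0).time (Kerr.background 0 0).radius (fun _ ↦ Minkowski.bilin) x =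
      Minkowski.outgoingNull x := by
  rw [Minkowski.outgoingNull]
  rw [outNull, outConormal, discr_flat hx, invTT_flat, invTR_flat hx, Real.sqrt_one, map_add,
    map_smul, map_smul, Kerr.fderiv_background_time, radius_background_zero,
    sharpAt_minkowski_dx_zero, sharpAt_minkowski_fderiv_spatialNorm hx]
  norm_num

/-- **`N = ∂₀ − r̂` for Minkowski components**: the ingoing null normal of the round sphere is
the ingoing null vector `∂_t − ∂_r` of Minkowski space (`Minkowski.ingoingNull`,
Dafermos–Rodnianski's `L̲`), as asserted. [cite: DafermosRodnianski2010ICMP, §3] -/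
theorem inNull_flat (hx : E4.spatial x ≠ 0) :
    inNull (Kerr.background 0 0).time (Kerr.background 0 0).radius (fun _ ↦ Minkowski.bilin) x =
      Minkowski.ingoingNull x := by
  rw [Minkowski.ingoingNull]
  rw [inNull, inConormal, discr_flat hx, invTT_flat, invTR_flat hx, Real.sqrt_one, map_add,
    map_smul, map_smul, Kerr.fderiv_background_time, radius_background_zero,
    sharpAt_minkowski_dx_zero, sharpAt_minkowski_fderiv_spatialNorm hx]
  norm_num
  abel


/-! #### The flat shears vanish: Minkowski space is a non-radiating limit pair -/

/-- The spatial position projector `x ↦ x − x⁰ ∂₀ = (0, x̲)`. [folklore] -/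
def spProj : E4 →L[ℝ] E4 :=
  ContinuousLinearMap.id ℝ E4 - (E4.dx 0).smulRight (E4.basisVector 0)

/-- `spProj x = x − x⁰ ∂₀`. [folklore] -/
theorem spProj_apply (x : E4) : spProj x = x - x 0 • E4.basisVector 0 := rfl

/-- `r̂ = |x̲|⁻¹ (x − x⁰ ∂₀)`. [folklore] -/
theorem radialUnit_eq (x : E4) : Minkowski.radialUnit x = (E4.spatialNorm x)⁻¹ • spProj x := by
  ext μ
  refine Fin.cases ?_ (fun i ↦ ?_) μ
  · simp [spProj_apply]
  · simp [spProj_apply, Fin.succ_ne_zero]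

/-- The tangential projector `Π_x = id − dx⁰ ⊗ ∂₀ − d|x̲| ⊗ r̂` onto the tangent plane of the round
sphere through `x`. [folklore] -/
def tangProj (x : E4) : E4 →L[ℝ] E4 :=
  spProj - (fderiv ℝ E4.spatialNorm x).smulRight (Minkowski.radialUnit x)

/-- `Π v = v − v⁰ ∂₀ − d|x̲|(v) r̂`. [folklore] -/
theorem tangProj_apply (x v : E4) :
    tangProj x v = v - v 0 • E4.basisVector 0 - fderiv ℝ E4.spatialNorm x v • Minkowski.radialUnit x := rfl

/-- `d|x̲|(r̂) = 1` off the time axis. [folklore] -/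
theorem fderiv_spatialNorm_radialUnit (hx : E4.spatial x ≠ 0) :
    fderiv ℝ E4.spatialNorm x (Minkowski.radialUnit x) = 1 := by
  have h := invRR_flat hx
  rwa [invRR, radius_background_zero, sharpAt_minkowski_fderiv_spatialNorm hx] at h

/-- `d|x̲|(∂₀) = 0`. [folklore] -/
theorem fderiv_spatialNorm_basisVector_zero (hx : E4.spatial x ≠ 0) :
    fderiv ℝ E4.spatialNorm x (E4.basisVector 0) = 0 := by
  rw [fderiv_spatialNorm_apply hx]
  simp [Fin.succ_ne_zero]

/-- `dx⁰(r̂) = 0`. [folklore] -/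
theorem dx_zero_radialUnit (x : E4) : E4.dx 0 (Minkowski.radialUnit x) = 0 := Minkowski.radialUnit_apply_zero x

/-- **The differential of the radial unit field**: `D r̂(x) = |x̲|⁻¹ Π_x` off the time axis.
[folklore] -/
theorem hasFDerivAt_radialUnit (hx : E4.spatial x ≠ 0) :
    HasFDerivAt Minkowski.radialUnit ((E4.spatialNorm x)⁻¹ • tangProj x) x := by
  have h0 : E4.spatialNorm x ≠ 0 := (norm_pos_iff.2 hx).ne'
  have hd : HasFDerivAt E4.spatialNorm (fderiv ℝ E4.spatialNorm x) x :=
    (hasFDerivAt_spatialNorm hx).differentiableAt.hasFDerivAt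
  have hc : HasFDerivAt (fun y ↦ (E4.spatialNorm y)⁻¹)
      ((-(E4.spatialNorm x ^ 2)⁻¹) • fderiv ℝ E4.spatialNorm x) x :=
    (hasDerivAt_inv h0).comp_hasFDerivAt x hd
  have hs := hc.smul (spProj).hasFDerivAt
  have hfun : ((fun y : E4 ↦ (E4.spatialNorm y)⁻¹) • ⇑spProj) = Minkowski.radialUnit :=
    funext fun y ↦ by rw [Pi.smul_apply', radialUnit_eq]
  rw [hfun] at hs
  have hsp : spProj x = E4.spatialNorm x • Minkowski.radialUnit x := by
    rw [radialUnit_eq, smul_smul, mul_inv_cancel₀ h0, one_smul]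
  rw [hsp] at hs
  refine hs.congr_fderiv (ContinuousLinearMap.ext fun v ↦ ?_)
  rw [tangProj, _root_.add_apply, _root_.smul_apply, ContinuousLinearMap.smulRight_apply,
    _root_.smul_apply, _root_.smul_apply, _root_.sub_apply, ContinuousLinearMap.smulRight_apply,
    smul_sub, sub_eq_add_neg, smul_eq_mul, smul_smul, smul_smul, ← neg_smul]
  congr 2
  field_simp


/-- `η(r̂, w) = d|x̲|(w)`: `r̂ = ♯d|x̲|`. [folklore] -/
theorem bilin_radialUnit (hx : E4.spatial x ≠ 0) (w : E4) :
    Minkowski.bilin (Minkowski.radialUnit x) w = fderiv ℝ E4.spatialNorm x w := by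
  rw [← sharpAt_minkowski_fderiv_spatialNorm hx]
  exact MetricCoord.apply_sharpAt_apply (G := fun _ : E4 ↦ Minkowski.bilin) isInvertible_minkowski _ w

/-- `η(w, r̂) = d|x̲|(w)`. [folklore] -/
theorem bilin_radialUnit_right (hx : E4.spatial x ≠ 0) (w : E4) :
    Minkowski.bilin w (Minkowski.radialUnit x) = fderiv ℝ E4.spatialNorm x w := by
  rw [Minkowski.bilin_symm, bilin_radialUnit hx]

/-- `(Π v)⁰ = 0`: `Π v` is spatial. [folklore] -/
theorem tangProj_apply_zero (x v : E4) : tangProj x v 0 = 0 := by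
  simp [tangProj_apply]

/-- `d|x̲|(Π v) = 0`: `Π v` is tangent to the round sphere (off the time axis). [folklore] -/
theorem fderiv_spatialNorm_tangProj (hx : E4.spatial x ≠ 0) (v : E4) :
    fderiv ℝ E4.spatialNorm x (tangProj x v) = 0 := by
  rw [tangProj_apply, map_sub, map_sub, map_smul, map_smul, fderiv_spatialNorm_basisVector_zero hx,
    fderiv_spatialNorm_radialUnit hx, smul_zero, sub_zero, smul_eq_mul, mul_one, sub_self]

/-- `η(Π v, ∂₀) = 0`. [folklore] -/
theorem bilin_tangProj_basisVector_zero (x v : E4) :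
    Minkowski.bilin (tangProj x v) (E4.basisVector 0) = 0 := by
  rw [Minkowski.bilin_symm, Minkowski.bilin_basisVector_zero_left, tangProj_apply_zero, neg_zero]

/-- `η(Π v, r̂) = 0`. [folklore] -/
theorem bilin_tangProj_radialUnit (hx : E4.spatial x ≠ 0) (v : E4) :
    Minkowski.bilin (tangProj x v) (Minkowski.radialUnit x) = 0 := by
  rw [bilin_radialUnit_right hx, fderiv_spatialNorm_tangProj hx]

/-- **`Π` is `η`-symmetric**: `η(Π v, w) = η(v, Π w)` (`= ⟪v̲, w̲⟫ − d|x̲|(v) d|x̲|(w)`, the induced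
metric of the round sphere extended by the tangential projection). [folklore] -/
theorem bilin_tangProj_comm (hx : E4.spatial x ≠ 0) (v w : E4) :
    Minkowski.bilin (tangProj x v) w = Minkowski.bilin v (tangProj x w) := by
  rw [tangProj_apply, tangProj_apply, map_sub, map_sub, map_smul, map_smul, _root_.sub_apply,
    _root_.sub_apply, _root_.smul_apply, _root_.smul_apply, map_sub, map_sub, map_smul, map_smul,
    Minkowski.bilin_basisVector_zero_left, bilin_radialUnit hx,
    show Minkowski.bilin v (E4.basisVector 0) = -v 0 by
      rw [Minkowski.bilin_symm, Minkowski.bilin_basisVector_zero_left],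
    bilin_radialUnit_right hx]
  simp only [smul_eq_mul]
  ring

/-- **`Π` is idempotent.** [folklore] -/
theorem tangProj_comp_tangProj (hx : E4.spatial x ≠ 0) :
    (tangProj x).comp (tangProj x) = tangProj x := by
  ext1 v
  rw [ContinuousLinearMap.comp_apply, tangProj_apply x (tangProj x v), tangProj_apply_zero,
    fderiv_spatialNorm_tangProj hx, zero_smul, zero_smul, sub_zero, sub_zero]

/-- **`tr Π = 2`**: the tangent planes of the round spheres are `2`-dimensional
(`tr id − dx⁰(∂₀) − d|x̲|(r̂) = 4 − 1 − 1`). [folklore] -/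
theorem trace_tangProj (hx : E4.spatial x ≠ 0) :
    LinearMap.trace ℝ E4 (tangProj x : E4 →ₗ[ℝ] E4) = 2 := by
  have h1 : ((tangProj x : E4 →L[ℝ] E4) : E4 →ₗ[ℝ] E4) =
      LinearMap.id - ((E4.dx 0 : E4 →L[ℝ] ℝ) : E4 →ₗ[ℝ] ℝ).smulRight (E4.basisVector 0) -
        ((fderiv ℝ E4.spatialNorm x : E4 →L[ℝ] ℝ) : E4 →ₗ[ℝ] ℝ).smulRight (Minkowski.radialUnit x) := by
    apply LinearMap.ext
    intro v
    rfl
  rw [h1, map_sub, map_sub, LinearMap.trace_id, LinearMap.trace_smulRight, LinearMap.trace_smulRight,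
    finrank_euclideanSpace_fin]
  rw [ContinuousLinearMap.coe_coe, ContinuousLinearMap.coe_coe, fderiv_spatialNorm_radialUnit hx]
  norm_num

/-- The flat null normals are `∂₀ ∓ r̂` on a neighbourhood of every point off the time axis, so
`DN = −|x̲|⁻¹ Π`. [folklore] -/
theorem fderiv_inNull_flat (hx : E4.spatial x ≠ 0) :
    fderiv ℝ (inNull (Kerr.background 0 0).time (Kerr.background 0 0).radius
        (fun _ ↦ Minkowski.bilin)) x = -((E4.spatialNorm x)⁻¹ • tangProj x) := by
  have hopen : IsOpen {y : E4 | E4.spatial y ≠ 0} := isOpen_ne_fun E4.spatial.continuous continuous_const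
  have hev : inNull (Kerr.background 0 0).time (Kerr.background 0 0).radius (fun _ ↦ Minkowski.bilin)
      =ᶠ[𝓝 x] fun y ↦ E4.basisVector 0 - Minkowski.radialUnit y :=
    Filter.eventually_of_mem (hopen.mem_nhds hx) fun y hy ↦ (inNull_flat hy :)
  rw [hev.fderiv_eq, fderiv_const_sub, (hasFDerivAt_radialUnit hx).fderiv]

/-- `DL = +|x̲|⁻¹ Π` off the time axis. [folklore] -/
theorem fderiv_outNull_flat (hx : E4.spatial x ≠ 0) :
    fderiv ℝ (outNull (Kerr.background 0 0).time (Kerr.background 0 0).radius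
        (fun _ ↦ Minkowski.bilin)) x = (E4.spatialNorm x)⁻¹ • tangProj x := by
  have hopen : IsOpen {y : E4 | E4.spatial y ≠ 0} := isOpen_ne_fun E4.spatial.continuous continuous_const
  have hev : outNull (Kerr.background 0 0).time (Kerr.background 0 0).radius (fun _ ↦ Minkowski.bilin)
      =ᶠ[𝓝 x] fun y ↦ E4.basisVector 0 + Minkowski.radialUnit y :=
    Filter.eventually_of_mem (hopen.mem_nhds hx) fun y hy ↦ (outNull_flat hy :)
  rw [hev.fderiv_eq, fderiv_const_add, (hasFDerivAt_radialUnit hx).fderiv]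

/-- **The Lie derivative of `η` along the flat ingoing null normal** is pure trace on the round
spheres: `ℒ_N η = −(2/|x̲|) η(Π ·, ·)`. [folklore] -/
theorem lieDerivAt_inNull_flat (hx : E4.spatial x ≠ 0) :
    MetricCoord.lieDerivAt (fun _ ↦ Minkowski.bilin)
        (inNull (Kerr.background 0 0).time (Kerr.background 0 0).radius (fun _ ↦ Minkowski.bilin)) x =
      (-(2 / E4.spatialNorm x)) • (Minkowski.bilin).comp (tangProj x) := by
  ext v w
  rw [MetricCoord.lieDerivAt_apply, fderiv_inNull_flat hx, fderiv_const_apply]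
  simp only [_root_.zero_apply, _root_.neg_apply, _root_.smul_apply, ContinuousLinearMap.comp_apply,
    map_neg, map_smul, smul_eq_mul, zero_add]
  rw [← bilin_tangProj_comm hx v w]
  ring

/-- `ℒ_L η = +(2/|x̲|) η(Π ·, ·)` for the flat outgoing null normal. [folklore] -/
theorem lieDerivAt_outNull_flat (hx : E4.spatial x ≠ 0) :
    MetricCoord.lieDerivAt (fun _ ↦ Minkowski.bilin)
        (outNull (Kerr.background 0 0).time (Kerr.background 0 0).radius (fun _ ↦ Minkowski.bilin)) x =
      (2 / E4.spatialNorm x) • (Minkowski.bilin).comp (tangProj x) := by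
  ext v w
  rw [MetricCoord.lieDerivAt_apply, fderiv_outNull_flat hx, fderiv_const_apply]
  simp only [_root_.zero_apply, _root_.smul_apply, ContinuousLinearMap.comp_apply, map_smul, smul_eq_mul,
    zero_add]
  rw [← bilin_tangProj_comm hx v w]
  ring


/-- **The flat `q♯` inverts the induced metric**: `q♯ ∘ η(Π ·, ·) = Π`. [folklore] -/
theorem surfSharp_comp_bilin_tangProj (hx : E4.spatial x ≠ 0) :
    (surfSharp (Kerr.background 0 0).time (Kerr.background 0 0).radius (fun _ ↦ Minkowski.bilin) x).comp
        ((Minkowski.bilin).comp (tangProj x)) = tangProj x := by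
  ext1 v
  rw [ContinuousLinearMap.comp_apply, ContinuousLinearMap.comp_apply, surfSharp_apply, inNull_flat hx,
    outNull_flat hx, Minkowski.ingoingNull, Minkowski.outgoingNull, MetricCoord.sharpAt_apply (G := fun _ : E4 ↦ Minkowski.bilin) isInvertible_minkowski,
    map_sub (Minkowski.bilin (tangProj x v)), map_add (Minkowski.bilin (tangProj x v)),
    bilin_tangProj_basisVector_zero, bilin_tangProj_radialUnit hx, sub_zero, add_zero, zero_smul,
    zero_smul, add_zero, smul_zero, sub_zero]

/-- `η(Π ·, ·)` is a symmetric bilinear form. [folklore] -/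
theorem flip_bilin_comp_tangProj (hx : E4.spatial x ≠ 0) :
    ((Minkowski.bilin).comp (tangProj x)).flip = (Minkowski.bilin).comp (tangProj x) := by
  ext v w
  rw [ContinuousLinearMap.flip_apply, ContinuousLinearMap.comp_apply, ContinuousLinearMap.comp_apply,
    bilin_tangProj_comm hx w v, Minkowski.bilin_symm]

/-- **Pure-trace deformations have no shear**: if `ℒ_V η = c · η(Π ·, ·)` at `x` (as for the flat
null normals, `c = ∓ 2/|x̲|`), then `|σ_V|²_q = ¼ (2c² − ½ (2c)²) = 0`. [folklore] -/
theorem shearSq_flat_eq_zero (hx : E4.spatial x ≠ 0) {V : E4 → E4} {c : ℝ}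
    (h : MetricCoord.lieDerivAt (fun _ ↦ Minkowski.bilin) V x = c • (Minkowski.bilin).comp (tangProj x)) :
    shearSq (Kerr.background 0 0).time (Kerr.background 0 0).radius (fun _ ↦ Minkowski.bilin) V x = 0 := by
  rw [shearSq, surfNormSq, surfTrace, h, ContinuousLinearMap.flip_smul, flip_bilin_comp_tangProj hx,
    ContinuousLinearMap.comp_smul, surfSharp_comp_bilin_tangProj hx, ContinuousLinearMap.smul_comp,
    ContinuousLinearMap.comp_smul, tangProj_comp_tangProj hx, smul_smul, ContinuousLinearMap.toLinearMap_smul,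
    ContinuousLinearMap.toLinearMap_smul, map_smul, map_smul, trace_tangProj hx, smul_eq_mul, smul_eq_mul]
  ring

/-- **The flat ingoing null normals are shear-free**: `σ_N = 0` for `(η, x⁰, |x̲|)` off the time axis
(round spheres in Minkowski space are umbilic; no news). [folklore] -/
theorem shearSq_inNull_flat (hx : E4.spatial x ≠ 0) :
    shearSq (Kerr.background 0 0).time (Kerr.background 0 0).radius (fun _ ↦ Minkowski.bilin)
      (inNull (Kerr.background 0 0).time (Kerr.background 0 0).radius (fun _ ↦ Minkowski.bilin)) x = 0 :=
  shearSq_flat_eq_zero hx (lieDerivAt_inNull_flat hx)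

/-- **The flat outgoing null normals are shear-free**: `σ_L = 0` off the time axis. [folklore] -/
theorem shearSq_outNull_flat (hx : E4.spatial x ≠ 0) :
    shearSq (Kerr.background 0 0).time (Kerr.background 0 0).radius (fun _ ↦ Minkowski.bilin)
      (outNull (Kerr.background 0 0).time (Kerr.background 0 0).radius (fun _ ↦ Minkowski.bilin)) x = 0 :=
  shearSq_flat_eq_zero hx (lieDerivAt_outNull_flat hx)

end Flat

end CoordSphere

/-! ### Minkowski space is a non-radiating limit pair -/

namespace Kerr

/-- The Kerr–Schild slab shells are open, hence measurable. [folklore] -/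
theorem measurableSet_slabShell_background (M a τ₀ L ρ₁ ρ₂ : ℝ) :
    MeasurableSet ((Kerr.background M a).slabShell τ₀ L ρ₁ ρ₂) := by
  have h0 : Continuous fun x : E4 ↦ x 0 := (EuclideanSpace.proj (0 : Fin 4)).continuous
  have hr : Continuous (radius a) := continuous_radius a
  refine IsOpen.measurableSet ?_
  have h : (Kerr.background M a).slabShell τ₀ L ρ₁ ρ₂ =
      ({x : E4 | max (rPlus M a) 0 < radius a x} ∩ ({x : E4 | τ₀ < x 0} ∩ {x : E4 | x 0 < τ₀ + L})) ∩
        ({x : E4 | ρ₁ < radius a x} ∩ {x : E4 | radius a x < ρ₂}) := by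
    ext x
    simp only [mem_slabShell_background, mem_inter_iff, mem_setOf_eq, and_assoc]
  rw [h]
  exact ((isOpen_lt continuous_const hr).inter
    ((isOpen_lt continuous_const h0).inter (isOpen_lt h0 continuous_const))).inter
      ((isOpen_lt continuous_const hr).inter (isOpen_lt hr continuous_const))

/-- On the flat background every point of a slab shell is off the time axis. [folklore] -/
theorem spatial_ne_zero_of_mem_slabShell {τ₀ L ρ₁ ρ₂ : ℝ} {x : E4}
    (hx : x ∈ (Kerr.background 0 0).slabShell τ₀ L ρ₁ ρ₂) : E4.spatial x ≠ 0 := by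
  rw [mem_slabShell_background] at hx
  have h : 0 < radius 0 x := (le_max_right _ _).trans_lt hx.1
  rw [radius_zero_left] at h
  exact norm_pos_iff.1 h

/-- The focusing fluxes of `(η, 0)` on the flat background vanish for every shear-free field.
[folklore] -/
theorem focusingFlux_flat_eq_zero (τ₀ L ρ₁ ρ₂ : ℝ) {V : E4 → E4}
    (hV : ∀ x : E4, E4.spatial x ≠ 0 →
      CoordSphere.shearSq (Kerr.background 0 0).time (Kerr.background 0 0).radius
        (fun _ ↦ Minkowski.bilin) V x = 0) :
    (Kerr.background 0 0).focusingFlux τ₀ L (fun _ ↦ Minkowski.bilin) 0 V ρ₁ ρ₂ = 0 := by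
  rw [ModelBackground.focusingFlux_zero_measure,
    setLIntegral_congr_fun (measurableSet_slabShell_background 0 0 τ₀ L ρ₁ ρ₂) (g := fun _ ↦ 0)
      fun x hx ↦ by simp [hV x (spatial_ne_zero_of_mem_slabShell hx)],
    lintegral_zero]

/-- **Minkowski space is non-radiating.** The pair `(η, 0)` — Minkowski components, no defect
measure — on the slabs of the flat Kerr–Schild background `Kerr.background 0 0` (`t = x⁰`,
`r = |x̲|`, inner end `r_in = 0`) satisfies `Kerr.IsNonRadiatingLimit 0 0 τ₀ L`: the round spheres
are umbilic, so both null shears vanish identically, and there is no matter. The sanity statement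
"`(g_{M,a}, 0)` is non-radiating" requested by the route, in the case `M = a = 0`. [folklore] -/
theorem isNonRadiatingLimit_minkowski (τ₀ L : ℝ) :
    Kerr.IsNonRadiatingLimit 0 0 τ₀ L (fun _ ↦ Minkowski.bilin) 0 := by
  have hout : ∀ ρ₁ ρ₂ : ℝ,
      (Kerr.background 0 0).outgoingFlux τ₀ L (fun _ ↦ Minkowski.bilin) 0 ρ₁ ρ₂ = 0 := fun ρ₁ ρ₂ ↦
    focusingFlux_flat_eq_zero τ₀ L ρ₁ ρ₂ fun x hx ↦ CoordSphere.shearSq_inNull_flat hx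
  have hin : ∀ ρ₁ ρ₂ : ℝ,
      (Kerr.background 0 0).ingoingFlux τ₀ L (fun _ ↦ Minkowski.bilin) 0 ρ₁ ρ₂ = 0 := fun ρ₁ ρ₂ ↦
    focusingFlux_flat_eq_zero τ₀ L ρ₁ ρ₂ fun x hx ↦ CoordSphere.shearSq_outNull_flat hx
  have hax : ∀ x ∈ Subtype.val '' (Kerr.background 0 0).timeSlabIoo τ₀ L, E4.spatial x ≠ 0 := by
    rintro _ ⟨x, -, rfl⟩
    have h : 0 < radius 0 x.1 := (le_max_right _ _).trans_lt (mem_exterior.1 x.2)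
    rw [radius_zero_left] at h
    exact norm_pos_iff.1 h
  refine ⟨⟨fun x hx ↦ ?_, fun x hx ↦ ?_⟩, ?_, ?_⟩
  · rw [CoordSphere.invTT_flat]
    norm_num
  · rw [CoordSphere.discr_flat (hax x hx)]
    norm_num
  · simp only [hout]
    exact tendsto_const_nhds
  · simp only [hin, mul_zero]
    exact tendsto_const_nhds

end Kerr

end Literature.Geometry.Lorentzian

end
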